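import Literature.NumberTheory.Sieve.FriedlanderIwaniecSpinTheorem2Psi
import Literature.NumberTheory.Sieve.FriedlanderIwaniecPrimesAngularFourier
import Literature.NumberTheory.Sieve.DivisorBound
import HarnessLib

/-!
# Friedlander–Iwaniec, *The polynomial `X² + Y⁴` captures its primes*: Theorem 2 (the spin of the primes) from Theorem 2^ψ — the stripping (23.1) → (23.3)

Family `parity` (rung F-SPIN). Source: J. Friedlander, H. Iwaniec, Ann. of Math. (2) 148 (1998),
945–1040 [FriedlanderIwaniecAnnals1998], Theorem 2 / (1.7) "`Σ_{r²+s²=p≤x} (s/r) ≪ x^{76/77}`",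
§23 (23.1)–(23.3): "In the quadratic eigenvalue (23.1) we focus on the symbol `[z]`, yet the presence
of the Hecke character `ψ` offers welcome flexibility by means of which one can create simpler objects
such as (23.3) `λ₀(n) = Σ_{r²+s²=n} (s/r)` where `r, s` are both positive and `r` is odd. Here one can
also put `r, s` into a prescribed sector and one can require these to be in fixed residue classes to
a given modulus. Theorem 2 concerns the eigenvalue (23.1) stripped to (23.3)."

The source does not write the stripping out; this file does (PROVED):

1. `spin_pairs_eq_sum_primary` — for odd `n`, the spin pairs `(r, s)` (`r, s ≥ 1`, `r` odd,
   `r² + s² = n`) correspond to the primary `w = a + bi` of norm `n` lying in the first or third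
   quadrant (`w = ±(r + is)`, the sign making `w` primary), and `(s/r) = (I^{(a-1)/2})⁻¹ (sgn a / |a|) [w]`.
2. The weight `(I^{(a-1)/2})⁻¹ (sgn a/|a|)` depends on `a (mod 8)` and the quadrant only; residue
   classes modulo `8 = 4·2` are detected by the characters `χ` of `ℤ[i]/(8)` [tree:
   `indicator_eq_sum_mulChar`], quadrants by the smooth windows `quadWin` expanded in the angular
   characters `(w/|w|)^k` [tree: `hasSum_fourier_quadWin`]; every resulting sum is
   `Σ_{n ≤ y} Λ(n) λ(n)` for a Hecke character `ψ = χ · (z/|z|)^k` of modulus `8`, bounded by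
   Theorem 2^ψ; the smoothing costs the primary `w` near the axes, `≪ Δ y + √y`.
3. Prime powers `p^j`, `j ≥ 2`, and the weight `log p` are removed (trivially / by partial summation).

Main results: `FriedlanderIwaniec1998_theorem2_powerSaving_of_theorem2psi` (Theorem 2 with a power
saving from Theorem 2^ψ with a power saving — the implication `stub_theorem2_of_theorem2psi` of the
F-SPIN line) and, with `FriedlanderIwaniec1998_theorem2psi_powerSaving_holds` [`…SpinTheorem2Psi`],
**`FriedlanderIwaniec1998_theorem2_powerSaving_holds`: the equidistribution of the spins of the primes
`p = r² + s²` with a power saving, PROVED** (the printed exponent `76/77` is not attempted).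

## References

* J. Friedlander, H. Iwaniec, Ann. of Math. (2) 148 (1998), 945–1040, Theorem 2, (1.7), §23
  (23.1)–(23.3), §26 Theorem 2^ψ. [FriedlanderIwaniecAnnals1998]

## Tree / Mathlib

Tree: `spinSum`, `heckePsi`, `quadEigenvalue`, `vonMangoldtEigenSum`, `FriedlanderIwaniec1998_theorem2psiWith`,
`…_theorem2psi_powerSaving`, `…_theorem2_powerSaving` (`FriedlanderIwaniecSpin`), `jacobiKubota`
(`…JacobiKubota`), `GaussQuot`, `toQuot`, `indicator_eq_sum_mulChar`, `isUnit_toQuot_of_coprime`,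
`card_mulChar_eq_card_units` (`…CharacterDetection`), `quadWin`, `hasSum_fourier_quadWin`,
`exists_bound_deriv3_smoothTransition`, `hasSum_one_div_int_sq` (`…AngularFourier`), `primaryNormLE`,
`norm_jacobiKubota_le_one` (`…LinearForms`), `exists_card_divisors_le_mul_rpow` (`DivisorBound`).
Mathlib: `jacobiSym.*`, `Complex.cos_arg`, `Complex.sin_arg`, `Real.sin_le`, `Finset.sum_range_by_parts`.
-/

noncomputable section

open Finset Complex Real
open scoped NumberTheorySymbols ArithmeticFunction.vonMangoldt

namespace Literature.NumberTheory.Sieve.FriedlanderIwaniecPrimes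

open Literature.NumberTheory.QuadraticFields Literature.NumberTheory.QuadraticFields.GaussianPrimary
open GaussianInt (toComplex)

/-! ### Step 1: spin pairs and primary numbers in the first and third quadrants -/

/-- The spin pairs of `n`: `(r, s)` with `1 ≤ r, s ≤ n`, `r² + s² = n`, `r` odd (the inner range of
`spinSum`). [cite: FriedlanderIwaniecAnnals1998, (1.7)] -/
def spinPairs (n : ℕ) : Finset (ℕ × ℕ) :=
  ((Icc 1 n) ×ˢ (Icc 1 n)).filter (fun rs : ℕ × ℕ => rs.1 ^ 2 + rs.2 ^ 2 = n ∧ Odd rs.1)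

/-- `w` lies in the (open) first or third quadrant: `sgn(Re w) = sgn(Im w) ≠ 0`.
[cite: FriedlanderIwaniecAnnals1998, §23 after (23.3)] -/
abbrev InQ13 (w : GaussianInt) : Prop := (0 < w.re ∧ 0 < w.im) ∨ (w.re < 0 ∧ w.im < 0)

/-- The primary numbers of norm `n` in the first or third quadrant. [cite: FriedlanderIwaniecAnnals1998, §23 after (23.3)] -/
def primaryQ13 (n : ℕ) : Finset GaussianInt := (primaryNormEq n).filter InQ13

/-- `unfold` lemma. [cite: FriedlanderIwaniecAnnals1998, §23 after (23.3)] -/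
theorem mem_primaryQ13 {n : ℕ} {w : GaussianInt} : w ∈ primaryQ13 n ↔ (w.norm = n ∧ IsPrimary w) ∧ InQ13 w := by
  rw [primaryQ13, mem_filter, mem_primaryNormEq]

/-- Exactly one of `±(r + is)` (`r` odd, `s` even) is primary. [folklore] -/
private theorem isPrimary_neg_iff {w : GaussianInt} (hr : Odd w.re) (hs : Even w.im) :
    IsPrimary (-w) ↔ ¬ IsPrimary w := by
  unfold IsPrimary
  rw [Int.odd_iff] at hr
  rw [Int.even_iff] at hs
  simp only [Zsqrtd.re_neg, Zsqrtd.im_neg]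
  omega

/-- The map from spin pairs to primary numbers: `(r, s) ↦ ±(r + is)`, the sign making it primary.
[folklore] -/
private def pairToPrimary (rs : ℕ × ℕ) : GaussianInt :=
  if IsPrimary (⟨rs.1, rs.2⟩ : GaussianInt) then ⟨rs.1, rs.2⟩ else -⟨rs.1, rs.2⟩

/-- **Spin pairs ↔ primary numbers in `Q1 ∪ Q3`** (`n` odd):
`Σ_{(r,s) spin pair} (s/r) = Σ_{w primary, N w = n, w ∈ Q1 ∪ Q3} (|Im w| / |Re w|)`.
[cite: FriedlanderIwaniecAnnals1998, (23.3)] -/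
theorem spin_pairs_eq_sum_primary {n : ℕ} (hn : Odd n) :
    ∑ rs ∈ spinPairs n, (J((rs.2 : ℤ) | rs.1) : ℂ) =
      ∑ w ∈ primaryQ13 n, (J((w.im.natAbs : ℤ) | w.re.natAbs) : ℂ) := by
  refine sum_nbij' pairToPrimary (fun w => (w.re.natAbs, w.im.natAbs)) ?_ ?_ ?_ ?_ ?_
  · -- into
    rintro ⟨r, s⟩ hrs
    rw [spinPairs, mem_filter, mem_product, mem_Icc, mem_Icc] at hrs
    obtain ⟨⟨⟨hr1, -⟩, ⟨hs1, -⟩⟩, hsum, hro⟩ := hrs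
    have hse : Even s := by
      have h1 : Odd (r ^ 2) := hro.pow
      by_contra h
      rw [Nat.not_even_iff_odd] at h
      have h2 : Odd (s ^ 2) := h.pow
      have : Even (r ^ 2 + s ^ 2) := h1.add_odd h2
      rw [hsum] at this
      exact (Nat.not_even_iff_odd.mpr hn) this
    have hro' : Odd ((⟨r, s⟩ : GaussianInt).re) := by simpa using (hro.natCast : Odd (r : ℤ))
    have hse' : Even ((⟨r, s⟩ : GaussianInt).im) := by simpa using (hse.natCast : Even (s : ℤ))
    have hnorm : ∀ w : GaussianInt, w = ⟨r, s⟩ ∨ w = -⟨r, s⟩ → w.norm = n := by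
      rintro w (rfl | rfl)
      · rw [Zsqrtd.norm_def]; simp; exact_mod_cast (by nlinarith [hsum] : (r * r + s * s : ℕ) = n)
      · rw [Zsqrtd.norm_neg, Zsqrtd.norm_def]; simp; exact_mod_cast (by nlinarith [hsum] : (r * r + s * s : ℕ) = n)
    rw [mem_primaryQ13]
    unfold pairToPrimary
    split_ifs with hp
    · exact ⟨⟨hnorm _ (Or.inl rfl), hp⟩, Or.inl ⟨by simp; omega, by simp; omega⟩⟩
    · exact ⟨⟨hnorm _ (Or.inr rfl), (isPrimary_neg_iff hro' hse').mpr hp⟩,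
        Or.inr ⟨by simp; omega, by simp; omega⟩⟩
  · -- back
    intro w hw
    rw [mem_primaryQ13] at hw
    obtain ⟨⟨hnorm, hp⟩, hq⟩ := hw
    have hodd : Odd w.re := by
      unfold IsPrimary at hp; rw [Int.odd_iff]; omega
    have hre0 : w.re ≠ 0 := by rcases hq with ⟨h, -⟩ | ⟨h, -⟩ <;> omega
    have him0 : w.im ≠ 0 := by rcases hq with ⟨-, h⟩ | ⟨-, h⟩ <;> omega
    have hn' : (n : ℤ) = w.re ^ 2 + w.im ^ 2 := by rw [← hnorm, Zsqrtd.norm_def]; ring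
    rw [spinPairs, mem_filter, mem_product, mem_Icc, mem_Icc]
    refine ⟨⟨⟨Int.natAbs_pos.mpr hre0, ?_⟩, ⟨Int.natAbs_pos.mpr him0, ?_⟩⟩, ?_, Int.natAbs_odd.mpr hodd⟩
    · have h1 : (w.re.natAbs : ℤ) ≤ w.re ^ 2 := Int.natAbs_le_self_sq _
      have : (w.re.natAbs : ℤ) ≤ n := by nlinarith [sq_nonneg w.im]
      exact_mod_cast this
    · have h1 : (w.im.natAbs : ℤ) ≤ w.im ^ 2 := Int.natAbs_le_self_sq _
      have : (w.im.natAbs : ℤ) ≤ n := by nlinarith [sq_nonneg w.re]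
      exact_mod_cast this
    · have : ((w.re.natAbs ^ 2 + w.im.natAbs ^ 2 : ℕ) : ℤ) = n := by
        push_cast; rw [sq_abs, sq_abs, hn']
      exact_mod_cast this
  · -- left inverse
    rintro ⟨r, s⟩ -
    unfold pairToPrimary
    split_ifs <;> simp
  · -- right inverse
    intro w hw
    rw [mem_primaryQ13] at hw
    obtain ⟨⟨-, hp⟩, hq⟩ := hw
    have hodd : Odd w.re := by unfold IsPrimary at hp; rw [Int.odd_iff]; omega
    have heven : Even w.im := by unfold IsPrimary at hp; rw [Int.even_iff]; omega
    unfold pairToPrimary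
    rcases hq with ⟨ha, hb⟩ | ⟨ha, hb⟩
    · have e : (⟨(w.re.natAbs : ℕ), (w.im.natAbs : ℕ)⟩ : GaussianInt) = w := by
        ext <;> simp <;> omega
      simp only [e, if_pos hp]
    · have e : (⟨(w.re.natAbs : ℕ), (w.im.natAbs : ℕ)⟩ : GaussianInt) = -w := by
        ext <;> simp <;> omega
      have hnp : ¬ IsPrimary (-w) := by
        rw [isPrimary_neg_iff hodd heven]; exact not_not.mpr hp
      simp only [e, if_neg hnp, neg_neg]
  · -- values
    rintro ⟨r, s⟩ -
    unfold pairToPrimary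
    split_ifs <;> simp

/-- **The spin as a weighted Jacobi–Kubota symbol**: for `w = a + bi` with `a` odd in `Q1 ∪ Q3`,
`(|b| / |a|) = (I^{(a-1)/2})⁻¹ · (sgn a / |a|) · [w]`. [cite: FriedlanderIwaniecAnnals1998, (23.2)–(23.3)] -/
theorem jacobiSym_natAbs_eq_weight_mul_jacobiKubota {w : GaussianInt} (hq : InQ13 w) :
    (J((w.im.natAbs : ℤ) | w.re.natAbs) : ℂ) =
      (Complex.I ^ ((w.re - 1) / 2))⁻¹ * (J(w.re.sign | w.re.natAbs) : ℂ) * jacobiKubota w := by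
  have hre0 : w.re ≠ 0 := by rcases hq with ⟨h, -⟩ | ⟨h, -⟩ <;> omega
  haveI : NeZero w.re.natAbs := ⟨Int.natAbs_ne_zero.mpr hre0⟩
  have hsgn : w.im = w.re.sign * (w.im.natAbs : ℤ) := by
    rcases hq with ⟨ha, hb⟩ | ⟨ha, hb⟩
    · rw [Int.sign_eq_one_of_pos ha, one_mul]; exact (Int.natAbs_of_nonneg hb.le).symm
    · rw [Int.sign_eq_neg_one_of_neg ha]; omega
  have hsq : (J(w.re.sign | w.re.natAbs) : ℂ) * J(w.re.sign | w.re.natAbs) = 1 := by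
    have hne : J(w.re.sign | w.re.natAbs) ≠ 0 := by
      rw [Ne, jacobiSym.eq_zero_iff_not_coprime, not_not]
      rcases lt_or_gt_of_ne hre0 with h | h
      · rw [Int.sign_eq_neg_one_of_neg h]; exact Int.isCoprime_iff_gcd_eq_one.mp isCoprime_one_left.neg_left
      · rw [Int.sign_eq_one_of_pos h]; exact Int.isCoprime_iff_gcd_eq_one.mp isCoprime_one_left
    rcases jacobiSym.trichotomy w.re.sign w.re.natAbs with h | h | h
    · exact absurd h hne
    · rw [h]; norm_num
    · rw [h]; norm_num
  have hI : Complex.I ^ ((w.re - 1) / 2) ≠ 0 := zpow_ne_zero _ Complex.I_ne_zero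
  have e : J(w.im | w.re.natAbs) = J(w.re.sign | w.re.natAbs) * J((w.im.natAbs : ℤ) | w.re.natAbs) := by
    conv_lhs => rw [hsgn]
    exact jacobiSym.mul_left _ _ _
  rw [jacobiKubota_def, e, Int.cast_mul]
  calc (J((w.im.natAbs : ℤ) | w.re.natAbs) : ℂ)
      = ((Complex.I ^ ((w.re - 1) / 2))⁻¹ * Complex.I ^ ((w.re - 1) / 2)) *
          ((J(w.re.sign | w.re.natAbs) : ℂ) * J(w.re.sign | w.re.natAbs)) * J((w.im.natAbs : ℤ) | w.re.natAbs) := by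
        rw [inv_mul_cancel₀ hI, hsq]; ring
    _ = _ := by ring

/-! ### Step 2: quadrants through the smooth angular windows -/

/-- The argument of `w` as a complex number, in `(-π, π]`. [folklore] -/
def gArg (w : GaussianInt) : ℝ := Complex.arg (toComplex w)

/-- The open first quadrant. [cite: FriedlanderIwaniecAnnals1998, §23 after (23.3)] -/
abbrev InQ1 (w : GaussianInt) : Prop := 0 < w.re ∧ 0 < w.im

/-- The open third quadrant. [cite: FriedlanderIwaniecAnnals1998, §23 after (23.3)] -/
abbrev InQ3 (w : GaussianInt) : Prop := w.re < 0 ∧ w.im < 0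

/-- Basic polar facts for `w ≠ 0`: `Re w = |w| cos θ`, `Im w = |w| sin θ`, `θ ∈ (-π, π]`. [folklore] -/
private theorem polar_facts {w : GaussianInt} (hw : w ≠ 0) :
    0 < ‖toComplex w‖ ∧ (w.re : ℝ) = ‖toComplex w‖ * Real.cos (gArg w) ∧
      (w.im : ℝ) = ‖toComplex w‖ * Real.sin (gArg w) ∧ -π < gArg w ∧ gArg w ≤ π := by
  have hw' : toComplex w ≠ 0 := fun h => hw (GaussianInt.toComplex_eq_zero.mp h)
  have hR : 0 < ‖toComplex w‖ := norm_pos_iff.mpr hw'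
  refine ⟨hR, ?_, ?_, (Complex.arg_mem_Ioc _).1, (Complex.arg_mem_Ioc _).2⟩
  · rw [gArg, Complex.cos_arg hw', GaussianInt.intCast_re]; field_simp
  · rw [gArg, Complex.sin_arg, GaussianInt.intCast_im]; field_simp

/-- The angular core: if `sin φ ≥ Δ > 0`, `cos φ ≥ Δ` and `φ ∈ (-π, π]` then `Δ ≤ φ ≤ π/2 - Δ`. [folklore] -/
private theorem angle_core {φ Δ : ℝ} (hΔ : 0 < Δ) (hφ0 : -π < φ) (hφπ : φ ≤ π) (hs : Δ ≤ Real.sin φ)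
    (hc : Δ ≤ Real.cos φ) : Δ ≤ φ ∧ φ ≤ π / 2 - Δ := by
  have hpos : 0 < φ := by
    by_contra h; push Not at h
    have := Real.sin_nonpos_of_nonpos_of_neg_pi_le h hφ0.le
    linarith
  have hlt : φ < π / 2 := by
    by_contra h; push Not at h
    have := Real.cos_nonpos_of_pi_div_two_le_of_le h (by linarith [Real.pi_pos])
    linarith
  refine ⟨hs.trans (Real.sin_le hpos.le), ?_⟩
  have h1 : Real.cos φ = Real.sin (π / 2 - φ) := (Real.sin_pi_div_two_sub φ).symm
  have h2 : Real.sin (π / 2 - φ) ≤ π / 2 - φ := Real.sin_le (by linarith)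
  linarith

/-- Inside `(0, π/2)` the point is in the first quadrant. [folklore] -/
private theorem pos_of_mem_Ioo {w : GaussianInt} (hw : w ≠ 0) {φ : ℝ} (hφ : φ = gArg w)
    (h1 : 0 < φ) (h2 : φ < π / 2) : InQ1 w := by
  obtain ⟨hR, hre, him, -, -⟩ := polar_facts hw
  have hs : 0 < Real.sin φ := Real.sin_pos_of_pos_of_lt_pi h1 (by linarith [Real.pi_pos])
  have hc : 0 < Real.cos φ := Real.cos_pos_of_mem_Ioo ⟨by linarith [Real.pi_pos], h2⟩
  rw [hφ] at hs hc
  have h1 : (0 : ℝ) < w.re := by rw [hre]; positivity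
  have h2 : (0 : ℝ) < w.im := by rw [him]; positivity
  exact ⟨by exact_mod_cast h1, by exact_mod_cast h2⟩

/-- **The first-quadrant window is exact away from the axes**: with `g₁ = quadWin (-π) 0 Δ`:
`g₁(arg w) = 0` if `w ∉ Q1`; `g₁(arg w) = 1` if `w ∈ Q1` and `Re w, Im w ≥ Δ|w|`; always `g₁ ∈ [0,1]`.
[cite: FriedlanderIwaniecAnnals1998, §23 after (23.3)] -/
theorem quadWin_one_spec {Δ : ℝ} (hΔ : 0 < Δ) (hΔ' : Δ ≤ π / 4) {w : GaussianInt} (hw : w ≠ 0) :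
    (¬ InQ1 w → quadWin (-π) 0 Δ (gArg w) = 0) ∧
      (InQ1 w → Δ * ‖toComplex w‖ ≤ w.re → Δ * ‖toComplex w‖ ≤ w.im → quadWin (-π) 0 Δ (gArg w) = 1) := by
  obtain ⟨hR, hre, him, hθ0, hθπ⟩ := polar_facts hw
  have hmod : toIocMod Real.two_pi_pos (-π) (gArg w) = gArg w := by
    rw [toIocMod_eq_self]; exact ⟨hθ0, by linarith⟩
  rw [quadWin_eq, hmod]
  constructor
  · intro hnq
    by_cases h0 : gArg w ≤ 0
    · exact quadProfile_eq_zero_of_le hΔ hΔ' h0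
    by_cases h2 : 0 + π / 2 ≤ gArg w
    · exact quadProfile_eq_zero_of_ge hΔ hΔ' h2
    push Not at h0 h2
    exact absurd (pos_of_mem_Ioo hw rfl h0 (by linarith)) hnq
  · intro hq ha hb
    have hs : Δ ≤ Real.sin (gArg w) := by
      rw [him] at hb; exact le_of_mul_le_mul_left (by linarith) hR
    have hc : Δ ≤ Real.cos (gArg w) := by
      rw [hre] at ha; exact le_of_mul_le_mul_left (by linarith) hR
    obtain ⟨h1, h2⟩ := angle_core hΔ hθ0 hθπ hs hc
    exact quadProfile_eq_one hΔ (by linarith) (by linarith)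

/-- **The third-quadrant window is exact away from the axes**: with `g₃ = quadWin (-2π) (-π) Δ`:
`g₃(arg w) = 0` if `w ∉ Q3`; `g₃(arg w) = 1` if `w ∈ Q3` and `-Re w, -Im w ≥ Δ|w|`.
[cite: FriedlanderIwaniecAnnals1998, §23 after (23.3)] -/
theorem quadWin_three_spec {Δ : ℝ} (hΔ : 0 < Δ) (hΔ' : Δ ≤ π / 4) {w : GaussianInt} (hw : w ≠ 0) :
    (¬ InQ3 w → quadWin (-(2 * π)) (-π) Δ (gArg w) = 0) ∧
      (InQ3 w → Δ * ‖toComplex w‖ ≤ -w.re → Δ * ‖toComplex w‖ ≤ -w.im →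
        quadWin (-(2 * π)) (-π) Δ (gArg w) = 1) := by
  obtain ⟨hR, hre, him, hθ0, hθπ⟩ := polar_facts hw
  have hπ := Real.pi_pos
  rw [quadWin_eq]
  by_cases hpos : 0 < gArg w
  · -- `θ > 0`: the reduction is `θ - 2π ≤ -π`, and `w ∉ Q3`
    have hmod : toIocMod Real.two_pi_pos (-(2 * π)) (gArg w) = gArg w - 2 * π := by
      rw [toIocMod_eq_iff]
      exact ⟨⟨by linarith, by linarith⟩, 1, by simp⟩
    rw [hmod]
    have hsin : 0 ≤ Real.sin (gArg w) := Real.sin_nonneg_of_nonneg_of_le_pi hpos.le hθπ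
    have him0 : (0 : ℝ) ≤ w.im := by rw [him]; positivity
    have hnq : ¬ InQ3 w := by
      intro h
      have h2 : (w.im : ℝ) < 0 := by exact_mod_cast h.2
      linarith
    exact ⟨fun _ => quadProfile_eq_zero_of_le hΔ hΔ' (by linarith), fun h => absurd h hnq⟩
  · push Not at hpos
    have hmod : toIocMod Real.two_pi_pos (-(2 * π)) (gArg w) = gArg w := by
      rw [toIocMod_eq_self]; exact ⟨by linarith, by linarith⟩
    rw [hmod]
    -- work with `φ = θ + π ∈ (0, π]`
    have hsφ : Real.sin (gArg w + π) = -Real.sin (gArg w) := Real.sin_add_pi _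
    have hcφ : Real.cos (gArg w + π) = -Real.cos (gArg w) := Real.cos_add_pi _
    constructor
    · intro hnq
      by_cases h2 : -π + π / 2 ≤ gArg w
      · exact quadProfile_eq_zero_of_ge hΔ hΔ' h2
      push Not at h2
      -- `θ ∈ (-π, -π/2)`: then `w ∈ Q3`
      exfalso; apply hnq
      have hs : Real.sin (gArg w) < 0 := by
        have : 0 < Real.sin (gArg w + π) :=
          Real.sin_pos_of_pos_of_lt_pi (by linarith) (by linarith)
        linarith
      have hc : Real.cos (gArg w) < 0 := by
        have : 0 < Real.cos (gArg w + π) := Real.cos_pos_of_mem_Ioo ⟨by linarith, by linarith⟩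
        linarith
      have h1 : (w.re : ℝ) < 0 := by rw [hre]; exact mul_neg_of_pos_of_neg hR hc
      have h2 : (w.im : ℝ) < 0 := by rw [him]; exact mul_neg_of_pos_of_neg hR hs
      exact ⟨by exact_mod_cast h1, by exact_mod_cast h2⟩
    · intro hq ha hb
      have hs : Δ ≤ Real.sin (gArg w + π) := by
        rw [hsφ]
        have : Δ * ‖toComplex w‖ ≤ ‖toComplex w‖ * (-Real.sin (gArg w)) := by rw [him] at hb; linarith
        exact le_of_mul_le_mul_left (by linarith) hR
      have hc : Δ ≤ Real.cos (gArg w + π) := by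
        rw [hcφ]
        have : Δ * ‖toComplex w‖ ≤ ‖toComplex w‖ * (-Real.cos (gArg w)) := by rw [hre] at ha; linarith
        exact le_of_mul_le_mul_left (by linarith) hR
      obtain ⟨h1, h2⟩ := angle_core hΔ (by linarith) (by linarith) hs hc
      exact quadProfile_eq_one hΔ (by linarith) (by linarith)

/-! ### Step 2b: counting primary numbers near the axes -/

/-- `|b| ≤ √N` if `a² + b² ≤ N`. [folklore] -/
private theorem natAbs_le_sqrt_of_sq_add {a b : ℤ} {N : ℕ} (h : a ^ 2 + b ^ 2 ≤ N) : b.natAbs ≤ Nat.sqrt N := by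
  rw [Nat.le_sqrt']
  have : (b.natAbs : ℤ) ^ 2 ≤ N := by rw [Int.natAbs_sq]; nlinarith [sq_nonneg a]
  exact_mod_cast this

/-- **Near-axis count**: the primary `w` with `1 ≤ |w|² ≤ y` and `|Re w| ≤ D` or `|Im w| ≤ D` number at
most `2(2D+1)(2√y+1)`. [cite: FriedlanderIwaniecAnnals1998, §23 after (23.3)] -/
theorem card_nearAxis_le (y D : ℕ) :
    (((primaryNormLE y).filter fun w => w.re.natAbs ≤ D ∨ w.im.natAbs ≤ D).card : ℝ) ≤
      2 * (2 * D + 1) * (2 * Nat.sqrt y + 1) := by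
  classical
  set s := Nat.sqrt y
  have hnorm : ∀ w ∈ primaryNormLE y, w.re ^ 2 + w.im ^ 2 ≤ (y : ℤ) := by
    intro w hw
    have := (mem_primaryNormLE.mp hw).2.2
    rw [Zsqrtd.norm_def] at this; linarith
  have hA : ((primaryNormLE y).filter fun w => w.re.natAbs ≤ D).card ≤ (2 * D + 1) * (2 * s + 1) := by
    have h := Finset.card_le_card_of_injOn (s := (primaryNormLE y).filter fun w => w.re.natAbs ≤ D)
      (t := Icc (-(D : ℤ)) D ×ˢ Icc (-(s : ℤ)) s) (fun w => (w.re, w.im)) ?_ ?_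
    · refine h.trans (le_of_eq ?_)
      rw [card_product, Int.card_Icc, Int.card_Icc]
      have e1 : ((D : ℤ) + 1 - -(D : ℤ)).toNat = 2 * D + 1 := by omega
      have e2 : ((s : ℤ) + 1 - -(s : ℤ)).toNat = 2 * s + 1 := by omega
      rw [e1, e2]
    · intro w hw
      rw [mem_coe, mem_filter] at hw
      have hb := natAbs_le_sqrt_of_sq_add (hnorm w hw.1)
      rw [mem_coe, mem_product, mem_Icc, mem_Icc]
      dsimp only
      refine ⟨⟨?_, ?_⟩, ?_, ?_⟩ <;> omega
    · intro w _ w' _ h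
      simp only [Prod.mk.injEq] at h
      exact Zsqrtd.ext h.1 h.2
  have hB : ((primaryNormLE y).filter fun w => w.im.natAbs ≤ D).card ≤ (2 * D + 1) * (2 * s + 1) := by
    have h := Finset.card_le_card_of_injOn (s := (primaryNormLE y).filter fun w => w.im.natAbs ≤ D)
      (t := Icc (-(D : ℤ)) D ×ˢ Icc (-(s : ℤ)) s) (fun w => (w.im, w.re)) ?_ ?_
    · refine h.trans (le_of_eq ?_)
      rw [card_product, Int.card_Icc, Int.card_Icc]
      have e1 : ((D : ℤ) + 1 - -(D : ℤ)).toNat = 2 * D + 1 := by omega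
      have e2 : ((s : ℤ) + 1 - -(s : ℤ)).toNat = 2 * s + 1 := by omega
      rw [e1, e2]
    · intro w hw
      rw [mem_coe, mem_filter] at hw
      have h' : w.im ^ 2 + w.re ^ 2 ≤ (y : ℤ) := by linarith [hnorm w hw.1]
      have hb := natAbs_le_sqrt_of_sq_add h'
      rw [mem_coe, mem_product, mem_Icc, mem_Icc]
      dsimp only
      refine ⟨⟨?_, ?_⟩, ?_, ?_⟩ <;> omega
    · intro w _ w' _ h
      simp only [Prod.mk.injEq] at h
      exact Zsqrtd.ext h.2 h.1
  have hunion : ((primaryNormLE y).filter fun w => w.re.natAbs ≤ D ∨ w.im.natAbs ≤ D) =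
      ((primaryNormLE y).filter fun w => w.re.natAbs ≤ D) ∪ ((primaryNormLE y).filter fun w => w.im.natAbs ≤ D) :=
    filter_or _ _ _
  rw [hunion]
  have h1 : ((((primaryNormLE y).filter fun w => w.re.natAbs ≤ D) ∪
        ((primaryNormLE y).filter fun w => w.im.natAbs ≤ D)).card : ℝ) ≤
      ((((primaryNormLE y).filter fun w => w.re.natAbs ≤ D).card +
        ((primaryNormLE y).filter fun w => w.im.natAbs ≤ D).card : ℕ) : ℝ) := by
    exact_mod_cast card_union_le _ _
  refine h1.trans ?_
  have h2 : ((((primaryNormLE y).filter fun w => w.re.natAbs ≤ D).card +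
        ((primaryNormLE y).filter fun w => w.im.natAbs ≤ D).card : ℕ) : ℝ) ≤
      (((2 * D + 1) * (2 * s + 1) + (2 * D + 1) * (2 * s + 1) : ℕ) : ℝ) := by
    exact_mod_cast add_le_add hA hB
  refine h2.trans (le_of_eq ?_)
  push_cast; ring

/-! ### Step 3: the Hecke-character sums behind a smooth angular window -/

/-- The angular character: `(w/|w|)^k = e^{ik arg w}` (`w ≠ 0`). [cite: FriedlanderIwaniecAnnals1998, (17.17)] -/
theorem angularChar_eq_exp {w : GaussianInt} (hw : w ≠ 0) (k : ℤ) :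
    (toComplex w / (‖toComplex w‖ : ℂ)) ^ k = Complex.exp (k * gArg w * Complex.I) := by
  have hw' : toComplex w ≠ 0 := fun h => hw (GaussianInt.toComplex_eq_zero.mp h)
  have hR : (‖toComplex w‖ : ℂ) ≠ 0 := by exact_mod_cast (norm_pos_iff.mpr hw').ne'
  have h := Complex.norm_mul_exp_arg_mul_I (toComplex w)
  have he : toComplex w / (‖toComplex w‖ : ℂ) = Complex.exp (Complex.arg (toComplex w) * Complex.I) := by
    rw [div_eq_iff hR, mul_comm]; exact h.symm
  rw [he, ← Complex.exp_int_mul, gArg]; ring_nf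

/-- `Σ_{n ≤ y} Λ(n) λ(n)` for `ψ = χ · (z/|z|)^k` of modulus `8`, written out.
[cite: FriedlanderIwaniecAnnals1998, (26.1)–(26.2)] -/
theorem vonMangoldtEigenSum_two_eq (χ : MulChar (GaussQuot (4 * 2)) ℂ) (k : ℤ) (y : ℕ) :
    vonMangoldtEigenSum 2 χ k 1 (y : ℝ) =
      ∑ n ∈ Icc 1 y, (Λ n : ℂ) * ∑ w ∈ primaryNormEq n,
        χ (toQuot (4 * 2) w) * Complex.exp (k * gArg w * Complex.I) * jacobiKubota w := by
  rw [vonMangoldtEigenSum, Nat.floor_natCast]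
  refine sum_congr rfl fun n _ => ?_
  rw [one_mul, quadEigenvalue]
  congr 1
  refine sum_congr rfl fun w hw => ?_
  rw [heckePsi, angularChar_eq_exp (mem_primaryNormEq.mp hw).2.ne_zero]

/-- **One character**: for `χ (mod 8)` and a window `g` with Fourier coefficients `|ĝ(0)| ≤ 1`,
`|ĝ(k)| ≤ B/|k|³`, the sum `Σ_{n ≤ y} Λ(n) Σ_{w primary, ww̄=n} χ(w) g(arg w) [w]` is
`Σ_k ĝ(k) Σ_{n ≤ y} Λ(n) λ_{χ,k}(n)`, hence `≤ C_ψ y^ϑ (1 + 8B)` by Theorem 2^ψ.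
[cite: FriedlanderIwaniecAnnals1998, §23 after (23.3), Theorem 2^ψ] -/
theorem norm_charWindowSum_le {ϑ Cψ : ℝ} (hCψ : 0 ≤ Cψ)
    (hψ : ∀ χ : MulChar (GaussQuot (4 * 2)) ℂ, ∀ k : ℤ, ∀ x : ℝ, 2 ≤ x →
      ‖vonMangoldtEigenSum 2 χ k 1 x‖ ≤ Cψ * (|k| + 1 : ℝ) * x ^ ϑ)
    {g : ℝ → ℝ} {ĝ : ℤ → ℂ} {B : ℝ} (hB : 0 ≤ B) (hg0 : ‖ĝ 0‖ ≤ 1)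
    (hgk : ∀ k : ℤ, k ≠ 0 → ‖ĝ k‖ ≤ B / |(k : ℝ)| ^ 3)
    (hsum : ∀ θ : ℝ, θ ∈ Set.Ioc (-Real.pi) Real.pi →
      HasSum (fun k : ℤ => ĝ k * Complex.exp (k * θ * Complex.I)) (g θ))
    (χ : MulChar (GaussQuot (4 * 2)) ℂ) {y : ℕ} (hy : 2 ≤ y) :
    ‖∑ n ∈ Icc 1 y, (Λ n : ℂ) * ∑ w ∈ primaryNormEq n,
        χ (toQuot (4 * 2) w) * (g (gArg w) : ℂ) * jacobiKubota w‖ ≤ Cψ * (y : ℝ) ^ ϑ * (1 + 8 * B) := by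
  set V : ℤ → ℂ := fun k => vonMangoldtEigenSum 2 χ k 1 (y : ℝ) with hV
  -- the Fourier expansion of the whole sum
  have hHS : HasSum (fun k : ℤ => ĝ k * V k)
      (∑ n ∈ Icc 1 y, (Λ n : ℂ) * ∑ w ∈ primaryNormEq n,
        χ (toQuot (4 * 2) w) * (g (gArg w) : ℂ) * jacobiKubota w) := by
    have hterm : ∀ n ∈ Icc 1 y, HasSum (fun k : ℤ => (Λ n : ℂ) * ∑ w ∈ primaryNormEq n,
        χ (toQuot (4 * 2) w) * (ĝ k * Complex.exp (k * gArg w * Complex.I)) * jacobiKubota w)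
        ((Λ n : ℂ) * ∑ w ∈ primaryNormEq n, χ (toQuot (4 * 2) w) * (g (gArg w) : ℂ) * jacobiKubota w) := by
      intro n _
      refine HasSum.mul_left _ (hasSum_sum fun w hw => ?_)
      have hw0 : w ≠ 0 := (mem_primaryNormEq.mp hw).2.ne_zero
      have hθ : gArg w ∈ Set.Ioc (-Real.pi) Real.pi := Complex.arg_mem_Ioc _
      have h := ((hsum _ hθ).mul_left (χ (toQuot (4 * 2) w))).mul_right (jacobiKubota w)
      exact h
    have h := hasSum_sum hterm
    refine h.congr_fun fun k => ?_
    show ĝ k * vonMangoldtEigenSum 2 χ k 1 (y : ℝ) = _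
    rw [vonMangoldtEigenSum_two_eq]
    simp only [mul_sum]
    refine sum_congr rfl fun n _ => sum_congr rfl fun w _ => ?_
    ring
  -- the majorant
  obtain ⟨S, hS4, hS⟩ := hasSum_one_div_int_sq
  have hy0 : (0 : ℝ) < y := by exact_mod_cast (by omega : 0 < y)
  have hyϑ : 0 ≤ (y : ℝ) ^ ϑ := by positivity
  set m : ℤ → ℝ := fun k => Cψ * (y : ℝ) ^ ϑ * ((if k = 0 then (1 : ℝ) else 0) + 2 * B * (1 / (k : ℝ) ^ 2))
  have hm : HasSum m (Cψ * (y : ℝ) ^ ϑ * (1 + 2 * B * S)) :=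
    ((hasSum_ite_eq (0 : ℤ) (1 : ℝ)).add (hS.mul_left (2 * B))).mul_left _
  have hbound : ∀ k, ‖ĝ k * V k‖ ≤ m k := by
    intro k
    have hVk : ‖V k‖ ≤ Cψ * (|k| + 1 : ℝ) * (y : ℝ) ^ ϑ := hψ χ k y (by exact_mod_cast hy)
    rw [norm_mul]
    by_cases hk : k = 0
    · subst hk
      have hV0 : ‖V 0‖ ≤ Cψ * (y : ℝ) ^ ϑ := hVk.trans (le_of_eq (by simp))
      simp only [m, if_true, Int.cast_zero]
      calc ‖ĝ 0‖ * ‖V 0‖ ≤ 1 * (Cψ * (y : ℝ) ^ ϑ) := mul_le_mul hg0 hV0 (norm_nonneg _) zero_le_one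
        _ = Cψ * (y : ℝ) ^ ϑ * (1 + 2 * B * (1 / (0 : ℝ) ^ 2)) := by simp
    · simp only [m, if_neg hk, zero_add]
      have hk1 : (1 : ℝ) ≤ |(k : ℝ)| := by
        rw [← Int.cast_abs]; exact_mod_cast Int.one_le_abs hk
      have hk0 : (0 : ℝ) < |(k : ℝ)| := by linarith
      calc ‖ĝ k‖ * ‖V k‖ ≤ (B / |(k : ℝ)| ^ 3) * (Cψ * (|k| + 1 : ℝ) * (y : ℝ) ^ ϑ) :=
            mul_le_mul (hgk k hk) hVk (norm_nonneg _) (by positivity)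
        _ = Cψ * (y : ℝ) ^ ϑ * (B * ((|(k : ℝ)| + 1) / |(k : ℝ)| ^ 3)) := by
            push_cast; ring
        _ ≤ Cψ * (y : ℝ) ^ ϑ * (B * (2 / |(k : ℝ)| ^ 2)) := by
            refine mul_le_mul_of_nonneg_left (mul_le_mul_of_nonneg_left ?_ hB) (by positivity)
            rw [div_le_div_iff₀ (by positivity) (by positivity)]
            nlinarith [sq_nonneg (|(k : ℝ)|), hk1]
        _ = Cψ * (y : ℝ) ^ ϑ * (2 * B * (1 / (k : ℝ) ^ 2)) := by rw [sq_abs]; ring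
  rw [← hHS.tsum_eq]
  calc ‖∑' k, ĝ k * V k‖ ≤ Cψ * (y : ℝ) ^ ϑ * (1 + 2 * B * S) := tsum_of_norm_bounded hm hbound
    _ ≤ Cψ * (y : ℝ) ^ ϑ * (1 + 8 * B) := by
        refine mul_le_mul_of_nonneg_left ?_ (by positivity)
        nlinarith

/-- **All characters: the windowed sum with a weight depending on `w (mod 8)`.** If `|wt| ≤ 1` and
`wt(w)` depends only on `w (mod 8)`, then
`|Σ_{n ≤ y} Λ(n) Σ_{w primary, ww̄ = n} g(arg w) wt(w) [w]| ≤ #(ℤ[i]/8) · C_ψ y^ϑ (1 + 8B)`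
(detect `w (mod 8)` by the characters of `(ℤ[i]/8)ˣ` [`indicator_eq_sum_mulChar`], then the previous
bound for each `χ`). [cite: FriedlanderIwaniecAnnals1998, §23 after (23.3) ("fixed residue classes to a given modulus")] -/
theorem norm_windowSum_le {ϑ Cψ : ℝ} (hCψ : 0 ≤ Cψ)
    (hψ : ∀ χ : MulChar (GaussQuot (4 * 2)) ℂ, ∀ k : ℤ, ∀ x : ℝ, 2 ≤ x →
      ‖vonMangoldtEigenSum 2 χ k 1 x‖ ≤ Cψ * (|k| + 1 : ℝ) * x ^ ϑ)
    {g : ℝ → ℝ} {ĝ : ℤ → ℂ} {B : ℝ} (hB : 0 ≤ B) (hg0 : ‖ĝ 0‖ ≤ 1)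
    (hgk : ∀ k : ℤ, k ≠ 0 → ‖ĝ k‖ ≤ B / |(k : ℝ)| ^ 3)
    (hsum : ∀ θ : ℝ, θ ∈ Set.Ioc (-Real.pi) Real.pi →
      HasSum (fun k : ℤ => ĝ k * Complex.exp (k * θ * Complex.I)) (g θ))
    {wt : GaussianInt → ℂ} (hwt1 : ∀ w, ‖wt w‖ ≤ 1)
    (hwt : ∀ w w' : GaussianInt, ((4 * 2 : ℕ) : GaussianInt) ∣ w - w' → wt w = wt w')
    {y : ℕ} (hy : 2 ≤ y) :
    ‖∑ n ∈ Icc 1 y, (Λ n : ℂ) * ∑ w ∈ primaryNormEq n, (g (gArg w) : ℂ) * wt w * jacobiKubota w‖ ≤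
      Fintype.card (GaussQuot (4 * 2)) * (Cψ * (y : ℝ) ^ ϑ * (1 + 8 * B)) := by
  classical
  haveI : NeZero (4 * 2) := ⟨by norm_num⟩
  -- the lifted weight on `ℤ[i]/8`
  set W : GaussQuot (4 * 2) → ℂ := fun u => wt (Ideal.Quotient.mk_surjective u).choose with hW
  have hWu : ∀ w : GaussianInt, W (toQuot (4 * 2) w) = wt w := by
    intro w
    have hspec := (Ideal.Quotient.mk_surjective (I := Ideal.span {((4 * 2 : ℕ) : GaussianInt)})
      (toQuot (4 * 2) w)).choose_spec
    refine hwt _ _ ((toQuot_eq_toQuot_iff _ _).mp ?_)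
    exact hspec
  have hW1 : ∀ u, ‖W u‖ ≤ 1 := fun u => hwt1 _
  -- expand `wt w = Σ_u [u = w mod 8] W u`
  have hexp : ∀ w : GaussianInt, wt w = ∑ u : GaussQuot (4 * 2), if u = toQuot (4 * 2) w then W u else 0 := by
    intro w; rw [Finset.sum_ite_eq' univ (toQuot (4 * 2) w) W, if_pos (mem_univ _), hWu]
  -- the per-character sums
  set T : MulChar (GaussQuot (4 * 2)) ℂ → ℂ := fun χ => ∑ n ∈ Icc 1 y, (Λ n : ℂ) *
    ∑ w ∈ primaryNormEq n, χ (toQuot (4 * 2) w) * (g (gArg w) : ℂ) * jacobiKubota w with hT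
  have hTle : ∀ χ, ‖T χ‖ ≤ Cψ * (y : ℝ) ^ ϑ * (1 + 8 * B) := fun χ =>
    norm_charWindowSum_le hCψ hψ hB hg0 hgk hsum χ hy
  -- the per-class sums
  set E : GaussQuot (4 * 2) → ℂ := fun u => ∑ n ∈ Icc 1 y, (Λ n : ℂ) *
    ∑ w ∈ primaryNormEq n, (g (gArg w) : ℂ) * (if u = toQuot (4 * 2) w then W u else 0) * jacobiKubota w
    with hE
  have hsplit : ∑ n ∈ Icc 1 y, (Λ n : ℂ) * ∑ w ∈ primaryNormEq n, (g (gArg w) : ℂ) * wt w * jacobiKubota w =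
      ∑ u : GaussQuot (4 * 2), E u := by
    simp only [hE]
    rw [sum_comm]
    refine sum_congr rfl fun n _ => ?_
    rw [← mul_sum, ]
    congr 1
    rw [sum_comm]
    refine sum_congr rfl fun w _ => ?_
    rw [hexp w, mul_sum, sum_mul]
  -- bound for each class
  have hEle : ∀ u, ‖E u‖ ≤ Cψ * (y : ℝ) ^ ϑ * (1 + 8 * B) := by
    intro u
    have hpos : 0 ≤ Cψ * (y : ℝ) ^ ϑ * (1 + 8 * B) := by
      have : (0 : ℝ) ≤ y := by positivity
      positivity
    by_cases hu : IsUnit u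
    · -- detect the class by characters
      set Φ : ℂ := (Fintype.card (GaussQuot (4 * 2))ˣ : ℂ) with hΦ
      have hind : ∀ w : GaussianInt, (if u = toQuot (4 * 2) w then W u else 0) =
          W u * (Φ⁻¹ * ∑ χ : MulChar (GaussQuot (4 * 2)) ℂ, (χ u)⁻¹ * χ (toQuot (4 * 2) w)) := by
        intro w
        have h := indicator_eq_sum_mulChar hu 1 (toQuot (4 * 2) w)
        simp only [one_mul, map_one] at h
        rw [← h]; split_ifs <;> simp
      have hEu : E u = W u * Φ⁻¹ * ∑ χ : MulChar (GaussQuot (4 * 2)) ℂ, (χ u)⁻¹ * T χ := by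
        simp only [hE, hT, hind, mul_sum, sum_mul]
        conv_rhs => rw [sum_comm]
        refine sum_congr rfl fun n _ => ?_
        conv_rhs => rw [sum_comm]
        refine sum_congr rfl fun w _ => sum_congr rfl fun χ _ => ?_
        ring
      rw [hEu]
      obtain ⟨uu, rfl⟩ := hu
      have hχu : ∀ χ : MulChar (GaussQuot (4 * 2)) ℂ, ‖(χ (uu : GaussQuot (4 * 2)))⁻¹‖ = 1 := fun χ => by
        rw [norm_inv, norm_mulChar_apply_units, inv_one]
      have hΦpos : (0 : ℝ) < Fintype.card (GaussQuot (4 * 2))ˣ := by exact_mod_cast Fintype.card_pos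
      have hΦnorm : ‖Φ⁻¹‖ = (Fintype.card (GaussQuot (4 * 2))ˣ : ℝ)⁻¹ := by
        rw [hΦ, norm_inv, Complex.norm_natCast]
      calc ‖W uu * Φ⁻¹ * ∑ χ : MulChar (GaussQuot (4 * 2)) ℂ, (χ (uu : GaussQuot (4 * 2)))⁻¹ * T χ‖
          ≤ 1 * (Fintype.card (GaussQuot (4 * 2))ˣ : ℝ)⁻¹ *
              ∑ χ : MulChar (GaussQuot (4 * 2)) ℂ, Cψ * (y : ℝ) ^ ϑ * (1 + 8 * B) := by
            rw [norm_mul, norm_mul, hΦnorm]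
            refine mul_le_mul (mul_le_mul_of_nonneg_right (hW1 _) (by positivity))
              ((norm_sum_le _ _).trans (sum_le_sum fun χ _ => ?_)) (norm_nonneg _) (by positivity)
            rw [norm_mul, hχu, one_mul]; exact hTle χ
        _ = Cψ * (y : ℝ) ^ ϑ * (1 + 8 * B) := by
            rw [sum_const, card_univ, card_mulChar_eq_card_units, nsmul_eq_mul]
            field_simp
    · -- a non-unit class contains no primary number
      have hzero : E u = 0 := by
        simp only [hE]
        refine sum_eq_zero fun n _ => ?_
        rw [sum_eq_zero fun w hw => ?_, mul_zero]
        have hunit : IsUnit (toQuot (4 * 2) w) := by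
          refine isUnit_toQuot_of_coprime ?_
          have hodd := (mem_primaryNormEq.mp hw).2.norm_odd
          have h2 : Nat.Coprime w.norm.natAbs 2 := by
            rw [Nat.coprime_comm, Nat.Prime.coprime_iff_not_dvd Nat.prime_two]
            omega
          rw [show (4 * 2 : ℕ) = 2 ^ 3 by norm_num]
          exact h2.pow_right 3
        rw [if_neg (fun h : u = toQuot (4 * 2) w => hu (h ▸ hunit)), mul_zero, zero_mul]
      rw [hzero, norm_zero]; exact hpos
  rw [hsplit]
  calc ‖∑ u : GaussQuot (4 * 2), E u‖ ≤ ∑ u : GaussQuot (4 * 2), Cψ * (y : ℝ) ^ ϑ * (1 + 8 * B) :=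
        (norm_sum_le _ _).trans (sum_le_sum fun u _ => hEle u)
    _ = Fintype.card (GaussQuot (4 * 2)) * (Cψ * (y : ℝ) ^ ϑ * (1 + 8 * B)) := by
        rw [sum_const, card_univ, nsmul_eq_mul]

/-! ### Step 4: the weights `(I^{(a-1)/2})⁻¹ (sgn a/|a|)` on the two quadrants -/

/-- The weight on the first quadrant: `(I^{(a-1)/2})⁻¹`. [cite: FriedlanderIwaniecAnnals1998, (23.2)] -/
def wt1 (w : GaussianInt) : ℂ := (Complex.I ^ ((w.re - 1) / 2))⁻¹

/-- The weight on the third quadrant: `(I^{(a-1)/2})⁻¹ · (-1/|a|)` written through `a (mod 4)`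
(`(-1/|a|) = 1` iff `|a| ≡ 1 (4)` iff `a ≡ 3 (4)` for `a < 0`). [cite: FriedlanderIwaniecAnnals1998, (23.2)] -/
def wt3 (w : GaussianInt) : ℂ := (Complex.I ^ ((w.re - 1) / 2))⁻¹ * (if w.re % 4 = 3 then 1 else -1)

/-- `‖(I^m)⁻¹‖ = 1`. [folklore] -/
private theorem norm_I_zpow_inv (m : ℤ) : ‖(Complex.I ^ m)⁻¹‖ = 1 := by
  rw [norm_inv, norm_zpow, Complex.norm_I, one_zpow, inv_one]

/-- `‖wt1‖ ≤ 1`. [cite: FriedlanderIwaniecAnnals1998, (23.2)] -/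
theorem norm_wt1_le (w : GaussianInt) : ‖wt1 w‖ ≤ 1 := (norm_I_zpow_inv _).le

/-- `‖wt3‖ ≤ 1`. [cite: FriedlanderIwaniecAnnals1998, (23.2)] -/
theorem norm_wt3_le (w : GaussianInt) : ‖wt3 w‖ ≤ 1 := by
  rw [wt3, norm_mul, norm_I_zpow_inv, one_mul]; split_ifs <;> simp

/-- `I^{(a-1)/2}` depends on `a (mod 8)`. [folklore] -/
private theorem I_zpow_half_congr {a a' : ℤ} (h : (8 : ℤ) ∣ a - a') :
    Complex.I ^ ((a - 1) / 2) = Complex.I ^ ((a' - 1) / 2) := by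
  obtain ⟨t, ht⟩ := h
  have ha : a - 1 = (a' - 1) + 4 * t * 2 := by linarith
  rw [ha, Int.add_mul_ediv_right _ _ two_ne_zero, zpow_add₀ Complex.I_ne_zero]
  have h4 : Complex.I ^ (4 * t) = 1 := by
    rw [zpow_mul]
    have : Complex.I ^ (4 : ℤ) = 1 := by
      rw [show (4 : ℤ) = ((4 : ℕ) : ℤ) by norm_num, zpow_natCast, show (4 : ℕ) = 2 * 2 from rfl, pow_mul,
        Complex.I_sq]; norm_num
    rw [this, one_zpow]
  rw [h4, mul_one]

/-- `wt1` depends on `w (mod 8)`. [cite: FriedlanderIwaniecAnnals1998, §23 after (23.3)] -/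
theorem wt1_congr (w w' : GaussianInt) (h : ((4 * 2 : ℕ) : GaussianInt) ∣ w - w') : wt1 w = wt1 w' := by
  rw [natCast_dvd_iff] at h
  have h8 : (8 : ℤ) ∣ w.re - w'.re := by have := h.1; rw [Zsqrtd.re_sub] at this; exact_mod_cast this
  rw [wt1, wt1, I_zpow_half_congr h8]

/-- `wt3` depends on `w (mod 8)`. [cite: FriedlanderIwaniecAnnals1998, §23 after (23.3)] -/
theorem wt3_congr (w w' : GaussianInt) (h : ((4 * 2 : ℕ) : GaussianInt) ∣ w - w') : wt3 w = wt3 w' := by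
  rw [natCast_dvd_iff] at h
  have h8 : (8 : ℤ) ∣ w.re - w'.re := by have := h.1; rw [Zsqrtd.re_sub] at this; exact_mod_cast this
  have h4 : w.re % 4 = w'.re % 4 := by obtain ⟨t, ht⟩ := h8; omega
  rw [wt3, wt3, I_zpow_half_congr h8, h4]

/-- On the first quadrant the weight is `wt1`. [cite: FriedlanderIwaniecAnnals1998, (23.2)] -/
theorem weight_eq_wt1 {w : GaussianInt} (hq : InQ1 w) :
    (Complex.I ^ ((w.re - 1) / 2))⁻¹ * (J(w.re.sign | w.re.natAbs) : ℂ) = wt1 w := by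
  rw [Int.sign_eq_one_of_pos hq.1, jacobiSym.one_left, wt1]; simp

/-- On the third quadrant the weight is `wt3` (`a` odd). [cite: FriedlanderIwaniecAnnals1998, (23.2)] -/
theorem weight_eq_wt3 {w : GaussianInt} (hq : InQ3 w) (hodd : Odd w.re) :
    (Complex.I ^ ((w.re - 1) / 2))⁻¹ * (J(w.re.sign | w.re.natAbs) : ℂ) = wt3 w := by
  have hodd' : Odd w.re.natAbs := Int.natAbs_odd.mpr hodd
  rw [Int.sign_eq_neg_one_of_neg hq.1, jacobiSym.at_neg_one hodd', χ₄_nat_eq_ite hodd', wt3]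
  have hlt := hq.1
  have hodd2 : w.re % 2 = 1 := Int.odd_iff.mp hodd
  by_cases h3 : w.re % 4 = 3
  · have : w.re.natAbs % 4 = 1 := by omega
    rw [if_pos this, if_pos h3]; push_cast; ring
  · have : ¬ (w.re.natAbs % 4 = 1) := by omega
    rw [if_neg this, if_neg h3]; push_cast; ring

/-- **The spin sum of `n` through the two quadrant weights**:
`Σ_{w primary, ww̄=n, Q1∪Q3} (I^{(a-1)/2})⁻¹(sgn a/|a|)[w] = Σ_{w primary, ww̄=n} (1_{Q1} wt1 + 1_{Q3} wt3)(w) [w]`.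
[cite: FriedlanderIwaniecAnnals1998, (23.1)–(23.3)] -/
theorem sum_primaryQ13_eq (n : ℕ) :
    ∑ w ∈ primaryQ13 n, (Complex.I ^ ((w.re - 1) / 2))⁻¹ * (J(w.re.sign | w.re.natAbs) : ℂ) * jacobiKubota w =
      ∑ w ∈ primaryNormEq n, ((if InQ1 w then (1 : ℂ) else 0) * wt1 w +
        (if InQ3 w then (1 : ℂ) else 0) * wt3 w) * jacobiKubota w := by
  rw [primaryQ13, sum_filter]
  refine sum_congr rfl fun w hw => ?_
  have hodd : Odd w.re := by
    have hp := (mem_primaryNormEq.mp hw).2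
    unfold IsPrimary at hp; rw [Int.odd_iff]; omega
  by_cases h1 : InQ1 w
  · have h3 : ¬ InQ3 w := fun h => by have := h1.1; have := h.1; omega
    rw [if_pos (show InQ13 w from Or.inl h1), if_pos h1, if_neg h3, weight_eq_wt1 h1]; ring
  by_cases h3 : InQ3 w
  · rw [if_pos (show InQ13 w from Or.inr h3), if_neg h1, if_pos h3, weight_eq_wt3 h3 hodd]; ring
  · have h13 : ¬ InQ13 w := fun h => h.elim h1 h3
    rw [if_neg h13, if_neg h1, if_neg h3]; ring

/-! ### Step 5: sharp quadrant versus smooth window (the near-axis error) -/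

/-- `|w| = √(ww̄) ≤ √y` for `ww̄ ≤ y`. [folklore] -/
private theorem norm_toComplex_le {w : GaussianInt} {y : ℕ} (h : w.norm ≤ y) : ‖toComplex w‖ ≤ Real.sqrt y := by
  have h1 : ‖toComplex w‖ ^ 2 = (w.norm : ℝ) := by
    rw [GaussianInt.intCast_real_norm, Complex.normSq_eq_norm_sq]
  have h2 : (w.norm : ℝ) ≤ y := by exact_mod_cast h
  rw [← Real.sqrt_sq (norm_nonneg (toComplex w)), h1]
  exact Real.sqrt_le_sqrt h2

/-- `Σ_{n ≤ y} Σ_{ww̄ = n} f(w) = Σ_{1 ≤ ww̄ ≤ y} f(w)`. [folklore] -/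
private theorem sum_Icc_sum_primaryNormEq (y : ℕ) (f : GaussianInt → ℝ) :
    ∑ n ∈ Icc 1 y, ∑ w ∈ primaryNormEq n, f w = ∑ w ∈ primaryNormLE y, f w := by
  rw [primaryNormLE, sum_biUnion]
  intro i _ j _ hij
  rw [Function.onFun, Finset.disjoint_left]
  intro z hi hj
  rw [mem_primaryNormEq] at hi hj
  exact hij (by exact_mod_cast hi.1.symm.trans hj.1)

/-- **The near-axis error**: if a window `g ∈ [0,1]` agrees with the indicator of `P` at every
primary `w` with `ww̄ ≤ y` off the strips `|Re w| ≤ D`, `|Im w| ≤ D`, then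
`|Σ_{n ≤ y} Λ(n) Σ_{ww̄=n} (1_P(w) - g(arg w)) wt(w) [w]| ≤ log y · 2(2D+1)(2√y+1)` (`|wt| ≤ 1`).
[cite: FriedlanderIwaniecAnnals1998, §23 after (23.3)] -/
theorem norm_sharp_sub_window_le {P : GaussianInt → Prop} [DecidablePred P] {g : ℝ → ℝ}
    (hg : ∀ θ, g θ ∈ Set.Icc (0 : ℝ) 1) {wt : GaussianInt → ℂ} (hwt : ∀ w, ‖wt w‖ ≤ 1) {y D : ℕ}
    (hexact : ∀ w : GaussianInt, IsPrimary w → w.norm ≤ y → ¬ (w.re.natAbs ≤ D ∨ w.im.natAbs ≤ D) →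
      g (gArg w) = if P w then 1 else 0) :
    ‖∑ n ∈ Icc 1 y, (Λ n : ℂ) * ∑ w ∈ primaryNormEq n,
        ((if P w then (1 : ℂ) else 0) - (g (gArg w) : ℂ)) * wt w * jacobiKubota w‖ ≤
      Real.log y * (2 * (2 * D + 1) * (2 * Nat.sqrt y + 1)) := by
  have hlogy : 0 ≤ Real.log y := by
    rcases Nat.eq_zero_or_pos y with rfl | hy
    · simp
    · exact Real.log_nonneg (by exact_mod_cast hy)
  -- termwise
  have hterm : ∀ n ∈ Icc 1 y, ‖(Λ n : ℂ) * ∑ w ∈ primaryNormEq n,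
      ((if P w then (1 : ℂ) else 0) - (g (gArg w) : ℂ)) * wt w * jacobiKubota w‖ ≤
      Real.log y * ∑ w ∈ primaryNormEq n, (if w.re.natAbs ≤ D ∨ w.im.natAbs ≤ D then (1 : ℝ) else 0) := by
    intro n hn
    rw [mem_Icc] at hn
    have hΛ : ‖(Λ n : ℂ)‖ ≤ Real.log y := by
      rw [Complex.norm_real, Real.norm_eq_abs, abs_of_nonneg ArithmeticFunction.vonMangoldt_nonneg]
      exact ArithmeticFunction.vonMangoldt_le_log.trans
        (Real.log_le_log (by exact_mod_cast hn.1) (by exact_mod_cast hn.2))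
    rw [norm_mul]
    refine mul_le_mul hΛ ((norm_sum_le _ _).trans (sum_le_sum fun w hw => ?_)) (norm_nonneg _) hlogy
    obtain ⟨hwn, hwp⟩ := mem_primaryNormEq.mp hw
    rw [norm_mul, norm_mul]
    by_cases hE : w.re.natAbs ≤ D ∨ w.im.natAbs ≤ D
    · -- near an axis: each factor has norm ≤ 1
      rw [if_pos hE]
      have h1 : ‖(if P w then (1 : ℂ) else 0) - (g (gArg w) : ℂ)‖ ≤ 1 := by
        obtain ⟨hg0, hg1⟩ := hg (gArg w)
        by_cases hP : P w
        · rw [if_pos hP, show (1 : ℂ) - (g (gArg w) : ℂ) = ((1 - g (gArg w) : ℝ) : ℂ) by push_cast; ring,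
            Complex.norm_real, Real.norm_eq_abs, abs_of_nonneg (by linarith)]; linarith
        · rw [if_neg hP, zero_sub, norm_neg, Complex.norm_real, Real.norm_eq_abs, abs_of_nonneg hg0]; exact hg1
      calc _ ≤ 1 * 1 * 1 := mul_le_mul (mul_le_mul h1 (hwt w) (norm_nonneg _) zero_le_one)
            (norm_jacobiKubota_le_one w) (norm_nonneg _) (by norm_num)
        _ = 1 := by ring
    · rw [if_neg hE, hexact w hwp (by rw [hwn]; exact_mod_cast hn.2) hE]
      have : (if P w then (1 : ℂ) else 0) - (((if P w then (1 : ℝ) else 0) : ℝ) : ℂ) = 0 := by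
        split_ifs <;> simp
      rw [this, norm_zero, zero_mul, zero_mul]
  calc _ ≤ ∑ n ∈ Icc 1 y, Real.log y * ∑ w ∈ primaryNormEq n,
        (if w.re.natAbs ≤ D ∨ w.im.natAbs ≤ D then (1 : ℝ) else 0) := (norm_sum_le _ _).trans (sum_le_sum hterm)
    _ = Real.log y * (((primaryNormLE y).filter fun w => w.re.natAbs ≤ D ∨ w.im.natAbs ≤ D).card : ℝ) := by
        rw [← mul_sum, sum_Icc_sum_primaryNormEq, ← sum_filter]; simp
    _ ≤ Real.log y * (2 * (2 * D + 1) * (2 * Nat.sqrt y + 1)) :=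
        mul_le_mul_of_nonneg_left (card_nearAxis_le y D) hlogy

/-- The exactness hypothesis for the first quadrant. [cite: FriedlanderIwaniecAnnals1998, §23 after (23.3)] -/
theorem quadWin_one_exact {Δ : ℝ} (hΔ : 0 < Δ) (hΔ' : Δ ≤ Real.pi / 4) {y D : ℕ} (hD : Δ * Real.sqrt y < D + 1)
    (w : GaussianInt) (hw : IsPrimary w) (hwy : w.norm ≤ y) (hE : ¬ (w.re.natAbs ≤ D ∨ w.im.natAbs ≤ D)) :
    quadWin (-Real.pi) 0 Δ (gArg w) = if InQ1 w then 1 else 0 := by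
  push Not at hE
  obtain ⟨h0, h1⟩ := quadWin_one_spec hΔ hΔ' hw.ne_zero
  have hR : Δ * ‖toComplex w‖ < (D : ℝ) + 1 :=
    (mul_le_mul_of_nonneg_left (norm_toComplex_le hwy) hΔ.le).trans_lt hD
  split_ifs with hq
  · refine h1 hq ?_ ?_
    · have : (D : ℝ) + 1 ≤ w.re := by
        have : (D + 1 : ℤ) ≤ w.re := by have := hq.1; omega
        exact_mod_cast this
      linarith
    · have : (D : ℝ) + 1 ≤ w.im := by
        have : (D + 1 : ℤ) ≤ w.im := by have := hq.2; omega
        exact_mod_cast this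
      linarith
  · exact h0 hq

/-- The exactness hypothesis for the third quadrant. [cite: FriedlanderIwaniecAnnals1998, §23 after (23.3)] -/
theorem quadWin_three_exact {Δ : ℝ} (hΔ : 0 < Δ) (hΔ' : Δ ≤ Real.pi / 4) {y D : ℕ} (hD : Δ * Real.sqrt y < D + 1)
    (w : GaussianInt) (hw : IsPrimary w) (hwy : w.norm ≤ y) (hE : ¬ (w.re.natAbs ≤ D ∨ w.im.natAbs ≤ D)) :
    quadWin (-(2 * Real.pi)) (-Real.pi) Δ (gArg w) = if InQ3 w then 1 else 0 := by
  push Not at hE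
  obtain ⟨h0, h1⟩ := quadWin_three_spec hΔ hΔ' hw.ne_zero
  have hR : Δ * ‖toComplex w‖ < (D : ℝ) + 1 :=
    (mul_le_mul_of_nonneg_left (norm_toComplex_le hwy) hΔ.le).trans_lt hD
  split_ifs with hq
  · refine h1 hq ?_ ?_
    · have : (D : ℝ) + 1 ≤ -w.re := by
        have : (D + 1 : ℤ) ≤ -w.re := by have := hq.1; omega
        exact_mod_cast this
      linarith
    · have : (D : ℝ) + 1 ≤ -w.im := by
        have : (D + 1 : ℤ) ≤ -w.im := by have := hq.2; omega
        exact_mod_cast this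
      linarith
  · exact h0 hq

/-! ### Step 6: the bound for `U(y) = Σ_{n ≤ y} Λ(n) A(n)` -/

/-- `A(n) = Σ_{w primary, ww̄ = n, Q1 ∪ Q3} (I^{(a-1)/2})⁻¹ (sgn a/|a|) [w]` — for an odd prime `p` this is
the spin `σ_p` (`spin_pairs_eq_sum_primary`, `jacobiSym_natAbs_eq_weight_mul_jacobiKubota`).
[cite: FriedlanderIwaniecAnnals1998, (23.3)] -/
def spinA (n : ℕ) : ℂ :=
  ∑ w ∈ primaryQ13 n, (Complex.I ^ ((w.re - 1) / 2))⁻¹ * (J(w.re.sign | w.re.natAbs) : ℂ) * jacobiKubota w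

/-- `|A(n)| ≤ τ(n)`. [cite: FriedlanderIwaniecAnnals1998, (23.3)] -/
theorem norm_spinA_le {n : ℕ} (hn : n ≠ 0) : ‖spinA n‖ ≤ (n.divisors.card : ℝ) := by
  rw [spinA]
  calc _ ≤ ∑ w ∈ primaryQ13 n, (1 : ℝ) := by
        refine (norm_sum_le _ _).trans (sum_le_sum fun w _ => ?_)
        rw [norm_mul, norm_mul, norm_I_zpow_inv, one_mul]
        calc _ ≤ 1 * 1 := mul_le_mul ?_ (norm_jacobiKubota_le_one w) (norm_nonneg _) zero_le_one
          _ = 1 := one_mul _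
        rcases jacobiSym.trichotomy w.re.sign w.re.natAbs with h | h | h <;> rw [h] <;> simp
    _ = (primaryQ13 n).card := by simp
    _ ≤ (primaryNormEq n).card := by exact_mod_cast card_le_card (filter_subset _ _)
    _ ≤ n.divisors.card := by exact_mod_cast card_primaryNormEq_le_card_divisors n hn

/-- **The bound for `U(y)`**: for `Δ ∈ (0, 1/2]`, `y ≥ 2`, `D` with `Δ√y < D + 1`,
`|Σ_{n ≤ y} Λ(n) A(n)| ≤ 2 (#(ℤ[i]/8) · C_ψ y^ϑ (1 + 16M/Δ³) + log y · 2(2D+1)(2√y+1))`.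
[cite: FriedlanderIwaniecAnnals1998, §23 (23.1)–(23.3), Theorem 2^ψ] -/
theorem norm_sum_vonMangoldt_spinA_le {ϑ Cψ : ℝ} (hCψ : 0 ≤ Cψ)
    (hψ : ∀ χ : MulChar (GaussQuot (4 * 2)) ℂ, ∀ k : ℤ, ∀ x : ℝ, 2 ≤ x →
      ‖vonMangoldtEigenSum 2 χ k 1 x‖ ≤ Cψ * (|k| + 1 : ℝ) * x ^ ϑ)
    {M : ℝ} (hM0 : 0 ≤ M) (hM : ∀ s, |deriv (deriv (deriv Real.smoothTransition)) s| ≤ M)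
    {Δ : ℝ} (hΔ : 0 < Δ) (hΔ2 : Δ ≤ 1 / 2) {y D : ℕ} (hy : 2 ≤ y) (hD : Δ * Real.sqrt y < D + 1) :
    ‖∑ n ∈ Icc 1 y, (Λ n : ℂ) * spinA n‖ ≤
      2 * (Fintype.card (GaussQuot (4 * 2)) * (Cψ * (y : ℝ) ^ ϑ * (1 + 8 * (2 * M / Δ ^ 3))) +
        Real.log y * (2 * (2 * D + 1) * (2 * Nat.sqrt y + 1))) := by
  have hπ := Real.pi_gt_three
  have hΔ' : Δ ≤ Real.pi / 4 := by linarith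
  have hB : 0 ≤ 2 * M / Δ ^ 3 := by positivity
  -- the two windows and their Fourier expansions
  obtain ⟨ĝ₁, hg₁0, hg₁k, -, hg₁s⟩ := hasSum_fourier_quadWin (c := -Real.pi) (q := 0) hM hΔ hΔ'
    (by linarith) (by linarith)
  obtain ⟨ĝ₃, hg₃0, hg₃k, -, hg₃s⟩ := hasSum_fourier_quadWin (c := -(2 * Real.pi)) (q := -Real.pi) hM hΔ hΔ'
    (by linarith) (by linarith)
  set g₁ : ℝ → ℝ := quadWin (-Real.pi) 0 Δ
  set g₃ : ℝ → ℝ := quadWin (-(2 * Real.pi)) (-Real.pi) Δ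
  -- split `A(n)`
  have hsplit : ∑ n ∈ Icc 1 y, (Λ n : ℂ) * spinA n =
      ∑ n ∈ Icc 1 y, (Λ n : ℂ) * ∑ w ∈ primaryNormEq n, (g₁ (gArg w) : ℂ) * wt1 w * jacobiKubota w +
      ∑ n ∈ Icc 1 y, (Λ n : ℂ) * ∑ w ∈ primaryNormEq n,
        ((if InQ1 w then (1 : ℂ) else 0) - (g₁ (gArg w) : ℂ)) * wt1 w * jacobiKubota w +
      (∑ n ∈ Icc 1 y, (Λ n : ℂ) * ∑ w ∈ primaryNormEq n, (g₃ (gArg w) : ℂ) * wt3 w * jacobiKubota w +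
      ∑ n ∈ Icc 1 y, (Λ n : ℂ) * ∑ w ∈ primaryNormEq n,
        ((if InQ3 w then (1 : ℂ) else 0) - (g₃ (gArg w) : ℂ)) * wt3 w * jacobiKubota w) := by
    simp only [← sum_add_distrib, ← mul_add, spinA, sum_primaryQ13_eq]
    refine sum_congr rfl fun n _ => ?_
    congr 1
    refine sum_congr rfl fun w _ => ?_
    ring
  rw [hsplit]
  have h1 := norm_windowSum_le hCψ hψ hB hg₁0 hg₁k hg₁s norm_wt1_le wt1_congr hy
  have h3 := norm_windowSum_le hCψ hψ hB hg₃0 hg₃k hg₃s norm_wt3_le wt3_congr hy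
  have e1 := norm_sharp_sub_window_le (P := InQ1) (fun θ => quadWin_mem_Icc hΔ hΔ' θ) norm_wt1_le
    (quadWin_one_exact hΔ hΔ' hD)
  have e3 := norm_sharp_sub_window_le (P := InQ3) (fun θ => quadWin_mem_Icc hΔ hΔ' θ) norm_wt3_le
    (quadWin_three_exact hΔ hΔ' hD)
  calc _ ≤ ‖∑ n ∈ Icc 1 y, (Λ n : ℂ) * ∑ w ∈ primaryNormEq n, (g₁ (gArg w) : ℂ) * wt1 w * jacobiKubota w‖ +
      ‖∑ n ∈ Icc 1 y, (Λ n : ℂ) * ∑ w ∈ primaryNormEq n,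
        ((if InQ1 w then (1 : ℂ) else 0) - (g₁ (gArg w) : ℂ)) * wt1 w * jacobiKubota w‖ +
      (‖∑ n ∈ Icc 1 y, (Λ n : ℂ) * ∑ w ∈ primaryNormEq n, (g₃ (gArg w) : ℂ) * wt3 w * jacobiKubota w‖ +
      ‖∑ n ∈ Icc 1 y, (Λ n : ℂ) * ∑ w ∈ primaryNormEq n,
        ((if InQ3 w then (1 : ℂ) else 0) - (g₃ (gArg w) : ℂ)) * wt3 w * jacobiKubota w‖) :=
        (norm_add_le _ _).trans (add_le_add (norm_add_le _ _) (norm_add_le _ _))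
    _ ≤ _ := by linarith

/-! ### Step 7: prime powers -/

/-- The number of prime powers `p^j ≤ y` with `j ≥ 2` is at most `(√y + 1)(log₂ y + 1)`. [folklore] -/
private theorem card_primePow_not_prime_le (y : ℕ) :
    ((Icc 1 y).filter fun n => IsPrimePow n ∧ ¬ n.Prime).card ≤ (Nat.sqrt y + 1) * (Nat.log 2 y + 1) := by
  classical
  have h := Finset.card_le_card_of_injOn (s := (Icc 1 y).filter fun n => IsPrimePow n ∧ ¬ n.Prime)
    (t := range (Nat.sqrt y + 1) ×ˢ range (Nat.log 2 y + 1))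
    (fun n => (n.minFac, n.factorization n.minFac)) ?_ ?_
  · rwa [card_product, card_range, card_range] at h
  · intro n hn
    rw [mem_coe, mem_filter, mem_Icc] at hn
    obtain ⟨⟨hn1, hny⟩, hpp, hnp⟩ := hn
    have hrec : n.minFac ^ n.factorization n.minFac = n := hpp.minFac_pow_factorization_eq
    have hp : n.minFac.Prime := Nat.minFac_prime (by rintro rfl; exact hnp.elim (by
      exact absurd hpp (by decide)))
    set k := n.factorization n.minFac with hk
    have hk2 : 2 ≤ k := by
      by_contra h
      push Not at h
      interval_cases k
      · rw [pow_zero] at hrec; rw [← hrec] at hpp; exact absurd hpp (by decide)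
      · rw [pow_one] at hrec; rw [← hrec] at hnp; exact hnp hp
    rw [mem_coe, mem_product, mem_range, mem_range, Nat.lt_succ_iff, Nat.lt_succ_iff]
    constructor
    · rw [Nat.le_sqrt]
      calc n.minFac * n.minFac = n.minFac ^ 2 := (sq _).symm
        _ ≤ n.minFac ^ k := Nat.pow_le_pow_right hp.pos hk2
        _ = n := hrec
        _ ≤ y := hny
    · refine Nat.le_log_of_pow_le (by norm_num) ?_
      calc 2 ^ k ≤ n.minFac ^ k := Nat.pow_le_pow_left hp.two_le k
        _ = n := hrec
        _ ≤ y := hny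
  · intro n hn n' hn' heq
    rw [mem_coe, mem_filter] at hn hn'
    simp only [Prod.mk.injEq] at heq
    obtain ⟨h1, h2⟩ := heq
    calc n = n.minFac ^ n.factorization n.minFac := hn.2.1.minFac_pow_factorization_eq.symm
      _ = n'.minFac ^ n'.factorization n'.minFac := by rw [h2, h1]
      _ = n' := hn'.2.1.minFac_pow_factorization_eq

/-- **The prime powers**: `|Σ_{n ≤ y, n not prime} Λ(n) A(n)| ≤ (√y+1)(log₂ y+1) · log y · C_τ y^{1/8}`.
[cite: FriedlanderIwaniecAnnals1998, §23 (23.3)] -/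
theorem norm_sum_notPrime_le {Cτ : ℝ} (hCτ : ∀ n : ℕ, n ≠ 0 → (n.divisors.card : ℝ) ≤ Cτ * (n : ℝ) ^ (1 / 8 : ℝ))
    {y : ℕ} (hy : 1 ≤ y) :
    ‖∑ n ∈ (Icc 1 y).filter (fun n => ¬ n.Prime), (Λ n : ℂ) * spinA n‖ ≤
      ((Nat.sqrt y + 1) * (Nat.log 2 y + 1) : ℕ) * (Real.log y * (Cτ * (y : ℝ) ^ (1 / 8 : ℝ))) := by
  have hy0 : (0 : ℝ) < y := by exact_mod_cast hy
  have hCτ0 : 0 ≤ Cτ := by have := hCτ 1 one_ne_zero; simp at this; linarith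
  -- only prime powers contribute
  have hzero : ∑ n ∈ (Icc 1 y).filter (fun n => ¬ n.Prime), (Λ n : ℂ) * spinA n =
      ∑ n ∈ (Icc 1 y).filter (fun n => IsPrimePow n ∧ ¬ n.Prime), (Λ n : ℂ) * spinA n := by
    rw [← Finset.sum_filter_of_ne (p := fun n => IsPrimePow n) (fun n _ hne => ?_), filter_filter]
    · exact sum_congr (by ext n; simp [and_comm]) fun _ _ => rfl
    · by_contra h
      apply hne
      rw [ArithmeticFunction.vonMangoldt_apply, if_neg h]; simp
  rw [hzero]
  have hterm : ∀ n ∈ (Icc 1 y).filter (fun n => IsPrimePow n ∧ ¬ n.Prime),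
      ‖(Λ n : ℂ) * spinA n‖ ≤ Real.log y * (Cτ * (y : ℝ) ^ (1 / 8 : ℝ)) := by
    intro n hn
    rw [mem_filter, mem_Icc] at hn
    have hn0 : n ≠ 0 := by omega
    rw [norm_mul, Complex.norm_real, Real.norm_eq_abs, abs_of_nonneg ArithmeticFunction.vonMangoldt_nonneg]
    refine mul_le_mul (ArithmeticFunction.vonMangoldt_le_log.trans
      (Real.log_le_log (by exact_mod_cast hn.1.1) (by exact_mod_cast hn.1.2))) ?_ (norm_nonneg _)
      (Real.log_nonneg (by exact_mod_cast hy))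
    exact (norm_spinA_le hn0).trans ((hCτ n hn0).trans (mul_le_mul_of_nonneg_left
      (Real.rpow_le_rpow (by positivity) (by exact_mod_cast hn.1.2) (by norm_num)) hCτ0))
  calc _ ≤ ∑ n ∈ (Icc 1 y).filter (fun n => IsPrimePow n ∧ ¬ n.Prime), Real.log y * (Cτ * (y : ℝ) ^ (1 / 8 : ℝ)) :=
        (norm_sum_le _ _).trans (sum_le_sum hterm)
    _ = (((Icc 1 y).filter fun n => IsPrimePow n ∧ ¬ n.Prime).card : ℝ) * (Real.log y * (Cτ * (y : ℝ) ^ (1 / 8 : ℝ))) := by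
        rw [sum_const, nsmul_eq_mul]
    _ ≤ _ := by
        refine mul_le_mul_of_nonneg_right (by exact_mod_cast card_primePow_not_prime_le y) ?_
        exact mul_nonneg (Real.log_nonneg (by exact_mod_cast hy)) (by positivity)

/-! ### Step 8: partial summation -/

/-- **Abel summation with an antitone nonnegative weight**: if all partial sums `Σ_{a ≤ n ≤ m} c(n)`
(`m ≤ N`) have norm `≤ B` and `f` is antitone and nonnegative on `[a, N]`, then
`|Σ_{a ≤ n ≤ N} c(n) f(n)| ≤ B f(a)`. [folklore] -/
private theorem norm_sum_Icc_mul_le_of_antitone {a N : ℕ} (haN : a ≤ N) {c : ℕ → ℂ} {f : ℕ → ℝ} {B : ℝ}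
    (hf0 : 0 ≤ f N) (hf : ∀ n, a ≤ n → n < N → f (n + 1) ≤ f n)
    (hB : ∀ m, a ≤ m → m ≤ N → ‖∑ n ∈ Icc a m, c n‖ ≤ B) :
    ‖∑ n ∈ Icc a N, c n * (f n : ℂ)‖ ≤ B * f a := by
  set S : ℕ → ℂ := fun m => ∑ n ∈ Icc a m, c n with hS
  -- summation by parts
  have hid : ∀ N, a ≤ N → ∑ n ∈ Icc a N, c n * (f n : ℂ) =
      S N * (f N : ℂ) + ∑ n ∈ Ico a N, S n * ((f n : ℂ) - f (n + 1)) := by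
    intro N hN
    induction N, hN using Nat.le_induction with
    | base => simp [hS]
    | succ N hN ih =>
      rw [sum_Icc_succ_top (by omega), ih, sum_Ico_succ_top hN]
      have : S (N + 1) = S N + c (N + 1) := by simp only [hS]; rw [sum_Icc_succ_top (by omega)]
      rw [this]; ring
  -- the telescoping sum
  have htel : ∀ N, a ≤ N → ∑ n ∈ Ico a N, (f n - f (n + 1)) = f a - f N := by
    intro N hN
    induction N, hN using Nat.le_induction with
    | base => simp
    | succ N hN ih => rw [sum_Ico_succ_top hN, ih]; ring
  have hB0 : 0 ≤ B := (norm_nonneg _).trans (hB a le_rfl haN)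
  rw [hid N haN]
  calc _ ≤ ‖S N * (f N : ℂ)‖ + ‖∑ n ∈ Ico a N, S n * ((f n : ℂ) - f (n + 1))‖ := norm_add_le _ _
    _ ≤ B * f N + ∑ n ∈ Ico a N, B * (f n - f (n + 1)) := by
        refine add_le_add ?_ ((norm_sum_le _ _).trans (sum_le_sum fun n hn => ?_))
        · rw [norm_mul, Complex.norm_real, Real.norm_eq_abs, abs_of_nonneg hf0]
          exact mul_le_mul_of_nonneg_right (hB N haN le_rfl) hf0
        · rw [mem_Ico] at hn
          have hdiff : 0 ≤ f n - f (n + 1) := by linarith [hf n hn.1 hn.2]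
          rw [norm_mul, show ((f n : ℂ) - f (n + 1)) = ((f n - f (n + 1) : ℝ) : ℂ) by push_cast; ring,
            Complex.norm_real, Real.norm_eq_abs, abs_of_nonneg hdiff]
          exact mul_le_mul_of_nonneg_right (hB n hn.1 hn.2.le) hdiff
    _ = B * f a := by rw [← mul_sum, htel N haN]; ring

/-! ### Step 9: the assembly -/

/-- The spin pair of `2`: `Σ_{(r,s) spin pair of 2} (s/r) = (1/1) = 1`. [cite: FriedlanderIwaniecAnnals1998, (1.7)] -/
theorem sum_spinPairs_two : ∑ rs ∈ spinPairs 2, (J((rs.2 : ℤ) | rs.1) : ℂ) = 1 := by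
  have h : spinPairs 2 = {(1, 1)} := by decide
  rw [h, sum_singleton]
  simp

/-- `A(2) = 0` (no primary number has norm `2`). [cite: FriedlanderIwaniecAnnals1998, (23.3)] -/
theorem spinA_two : spinA 2 = 0 := by
  rw [spinA, primaryQ13, primaryNormEq_eq_empty_of_even (dvd_refl 2)]; simp

/-- For an odd prime `p`, the spin pairs sum to `A(p)`. [cite: FriedlanderIwaniecAnnals1998, (23.3)] -/
theorem sum_spinPairs_eq_spinA {p : ℕ} (hp : Odd p) :
    ∑ rs ∈ spinPairs p, (J((rs.2 : ℤ) | rs.1) : ℂ) = spinA p := by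
  rw [spin_pairs_eq_sum_primary hp, spinA]
  refine sum_congr rfl fun w hw => ?_
  exact jacobiSym_natAbs_eq_weight_mul_jacobiKubota (mem_primaryQ13.mp hw).2

/-- **The spin sum through `A`**: for `N = ⌊x⌋ ≥ 2`,
`spinSum x = 1 + Σ_{2 < p ≤ N} A(p) = 1 + Σ_{1 ≤ n ≤ N} c(n)/log(max(n,2))` with
`c(n) = Λ(n) A(n)` for prime `n` and `0` otherwise. [cite: FriedlanderIwaniecAnnals1998, (1.7), (23.3)] -/
theorem spinSum_eq {x : ℝ} (hx : 2 ≤ ⌊x⌋₊) :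
    ((spinSum x : ℤ) : ℂ) = 1 + ∑ n ∈ Icc 1 ⌊x⌋₊,
      (if n.Prime then (Λ n : ℂ) * spinA n else 0) * ((1 / Real.log (max n 2 : ℕ) : ℝ) : ℂ) := by
  set N := ⌊x⌋₊
  rw [spinSum_def]
  simp only [Int.cast_sum]
  set P := (Icc 1 N).filter Nat.Prime with hP
  have h2 : 2 ∈ P := by rw [hP, mem_filter, mem_Icc]; exact ⟨⟨by norm_num, hx⟩, Nat.prime_two⟩
  have hspin : ∀ p ∈ P, ∑ rs ∈ ((Icc 1 p) ×ˢ (Icc 1 p)).filter (fun rs : ℕ × ℕ => rs.1 ^ 2 + rs.2 ^ 2 = p ∧ Odd rs.1),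
      (J((rs.2 : ℤ) | rs.1) : ℂ) = if p = 2 then 1 else spinA p := by
    intro p hp
    change ∑ rs ∈ spinPairs p, _ = _
    split_ifs with h
    · rw [h]; exact sum_spinPairs_two
    · exact sum_spinPairs_eq_spinA ((mem_filter.mp hp).2.odd_of_ne_two h)
  rw [sum_congr rfl hspin, ← add_sum_erase P _ h2, if_pos rfl]
  congr 1
  -- the right side as a sum over `P.erase 2`
  have hrhs : ∀ n ∈ Icc 1 N, (if n.Prime then (Λ n : ℂ) * spinA n else 0) * ((1 / Real.log (max n 2 : ℕ) : ℝ) : ℂ) =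
      if n ∈ P.erase 2 then spinA n else 0 := by
    intro n hn
    by_cases hpr : n.Prime
    · have hn2 : 2 ≤ n := hpr.two_le
      rw [if_pos hpr, max_eq_left hn2, ArithmeticFunction.vonMangoldt_apply_prime hpr]
      by_cases h2' : n = 2
      · subst h2'; rw [spinA_two]; simp
      · rw [if_pos (mem_erase.mpr ⟨h2', mem_filter.mpr ⟨hn, hpr⟩⟩)]
        have hlog : ((Real.log n : ℝ) : ℂ) ≠ 0 := by
          have : 0 < Real.log n := Real.log_pos (by exact_mod_cast (by omega : 1 < n))
          exact_mod_cast this.ne'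
        rw [Complex.ofReal_div, Complex.ofReal_one]
        field_simp
    · rw [if_neg hpr, if_neg (fun h => hpr (mem_filter.mp (mem_erase.mp h).2).2), zero_mul]
  rw [sum_congr rfl hrhs, ← sum_filter, Finset.filter_mem_eq_inter,
    inter_eq_right.mpr (fun n hn => (mem_filter.mp (mem_erase.mp hn).2).1)]
  refine sum_congr rfl fun p hp => ?_
  rw [if_neg (mem_erase.mp hp).1]

/-- **The partial sums `Σ_{n ≤ m} c(n)`** are `U(m) - PP(m)`. [cite: FriedlanderIwaniecAnnals1998, (23.3)] -/
theorem sum_c_eq (m : ℕ) :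
    ∑ n ∈ Icc 1 m, (if n.Prime then (Λ n : ℂ) * spinA n else 0) =
      ∑ n ∈ Icc 1 m, (Λ n : ℂ) * spinA n - ∑ n ∈ (Icc 1 m).filter (fun n => ¬ n.Prime), (Λ n : ℂ) * spinA n := by
  rw [← sum_filter, eq_sub_iff_add_eq, sum_filter_add_sum_filter_not]

/-- Numerics (i): the main term, `1/Δ³ ≤ 8 m^{3η}` and `m^ϑ m^{3η} = m^{1-η}`. [folklore] -/
private theorem numerics_main {m : ℕ} (hm : 2 ≤ m) {η ϑ t Δ Cψ M card : ℝ} (hη0 : 0 < η) (hη : η = (1 - ϑ) / 4)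
    (ht : t = (m : ℝ) ^ (-η)) (hΔlow : t / 2 ≤ Δ) (hCψ : 0 ≤ Cψ) (hM1 : 1 ≤ M) (hcard : 0 ≤ card) :
    card * (Cψ * (m : ℝ) ^ ϑ * (1 + 8 * (2 * M / Δ ^ 3))) ≤ card * (Cψ * (1 + 128 * M)) * (m : ℝ) ^ (1 - η / 2) := by
  have hm1 : (1 : ℝ) ≤ m := by exact_mod_cast (by omega : 1 ≤ m)
  have hm0 : (0 : ℝ) < m := by linarith
  have hpow : ∀ a b : ℝ, (m : ℝ) ^ a * (m : ℝ) ^ b = (m : ℝ) ^ (a + b) := fun a b => (Real.rpow_add hm0 a b).symm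
  have hmono : ∀ a b : ℝ, a ≤ b → (m : ℝ) ^ a ≤ (m : ℝ) ^ b := fun a b hab =>
    Real.rpow_le_rpow_of_exponent_le hm1 hab
  have ht0 : 0 < t := by rw [ht]; exact Real.rpow_pos_of_pos hm0 _
  have ht3 : t ^ 3 = ((m : ℝ) ^ (3 * η))⁻¹ := by
    rw [ht, ← Real.rpow_natCast, ← Real.rpow_mul hm0.le]; norm_num
    rw [show -(η * 3) = -(3 * η) by ring, Real.rpow_neg hm0.le]
  have hinvΔ : 1 / Δ ^ 3 ≤ 8 * (m : ℝ) ^ (3 * η) := by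
    have h1 : (t / 2) ^ 3 ≤ Δ ^ 3 := pow_le_pow_left₀ (by linarith) hΔlow 3
    calc 1 / Δ ^ 3 ≤ 1 / (t / 2) ^ 3 := one_div_le_one_div_of_le (by positivity) h1
      _ = 8 / t ^ 3 := by field_simp; ring
      _ = 8 * (m : ℝ) ^ (3 * η) := by rw [ht3, div_inv_eq_mul]
  have h1 : 8 * (2 * M / Δ ^ 3) ≤ 128 * M * (m : ℝ) ^ (3 * η) := by
    rw [show 8 * (2 * M / Δ ^ 3) = 16 * M * (1 / Δ ^ 3) by ring]
    nlinarith [hinvΔ, (by linarith : (0 : ℝ) ≤ 16 * M)]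
  have h2 : (m : ℝ) ^ ϑ * (1 + 128 * M * (m : ℝ) ^ (3 * η)) ≤ (1 + 128 * M) * (m : ℝ) ^ (1 - η / 2) := by
    have e1 : (m : ℝ) ^ ϑ ≤ (m : ℝ) ^ (1 - η / 2) := hmono _ _ (by rw [hη]; linarith)
    have e2 : (m : ℝ) ^ ϑ * (m : ℝ) ^ (3 * η) ≤ (m : ℝ) ^ (1 - η / 2) := by
      rw [hpow]; exact hmono _ _ (by rw [hη]; linarith)
    nlinarith [e1, e2, (by linarith : (0 : ℝ) ≤ 128 * M)]
  have h3 : Cψ * (m : ℝ) ^ ϑ * (1 + 8 * (2 * M / Δ ^ 3)) ≤ Cψ * (1 + 128 * M) * (m : ℝ) ^ (1 - η / 2) := by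
    have hmϑ : 0 ≤ (m : ℝ) ^ ϑ := by positivity
    calc Cψ * (m : ℝ) ^ ϑ * (1 + 8 * (2 * M / Δ ^ 3)) ≤ Cψ * (m : ℝ) ^ ϑ * (1 + 128 * M * (m : ℝ) ^ (3 * η)) :=
          mul_le_mul_of_nonneg_left (by linarith) (by positivity)
      _ = Cψ * ((m : ℝ) ^ ϑ * (1 + 128 * M * (m : ℝ) ^ (3 * η))) := by ring
      _ ≤ Cψ * ((1 + 128 * M) * (m : ℝ) ^ (1 - η / 2)) := mul_le_mul_of_nonneg_left h2 hCψ
      _ = _ := by ring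
  calc _ ≤ card * (Cψ * (1 + 128 * M) * (m : ℝ) ^ (1 - η / 2)) := mul_le_mul_of_nonneg_left h3 hcard
    _ = _ := by ring

/-- Numerics (ii): the near-axis term `log m · 2(2D+1)(2√m+1) ≤ (36/η) m^{1-η/2}`. [folklore] -/
private theorem numerics_err {m : ℕ} (hm : 2 ≤ m) {η t Δ : ℝ} (hη0 : 0 < η) (hη8 : η ≤ 1 / 8)
    (ht : t = (m : ℝ) ^ (-η)) (hΔ0 : 0 < Δ) (hΔt : Δ ≤ t) {D : ℕ} (hD : D = ⌊Δ * Real.sqrt m⌋₊) :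
    Real.log m * (2 * (2 * D + 1) * (2 * Nat.sqrt m + 1)) ≤ 36 / η * (m : ℝ) ^ (1 - η / 2) := by
  have hm1 : (1 : ℝ) ≤ m := by exact_mod_cast (by omega : 1 ≤ m)
  have hm0 : (0 : ℝ) < m := by linarith
  have hpow : ∀ a b : ℝ, (m : ℝ) ^ a * (m : ℝ) ^ b = (m : ℝ) ^ (a + b) := fun a b => (Real.rpow_add hm0 a b).symm
  have hsqrt : Real.sqrt m = (m : ℝ) ^ (1 / 2 : ℝ) := Real.sqrt_eq_rpow _
  have hlog : Real.log m ≤ 2 / η * (m : ℝ) ^ (η / 2) := by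
    have := Real.log_le_rpow_div hm0.le (by positivity : 0 < η / 2)
    rw [div_div_eq_mul_div] at this
    calc Real.log m ≤ (m : ℝ) ^ (η / 2) * 2 / η := this
      _ = 2 / η * (m : ℝ) ^ (η / 2) := by ring
  have hD1 : (2 * D + 1 : ℝ) ≤ 3 * (m : ℝ) ^ (1 / 2 - η) := by
    have hDle : (D : ℝ) ≤ (m : ℝ) ^ (1 / 2 - η) := by
      calc (D : ℝ) ≤ Δ * Real.sqrt m := by rw [hD]; exact Nat.floor_le (by positivity)
        _ ≤ t * Real.sqrt m := mul_le_mul_of_nonneg_right hΔt (Real.sqrt_nonneg _)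
        _ = (m : ℝ) ^ (1 / 2 - η) := by rw [ht, hsqrt, hpow]; ring_nf
    have := Real.one_le_rpow hm1 (by linarith : 0 ≤ 1 / 2 - η)
    linarith
  have hS1 : (2 * Nat.sqrt m + 1 : ℝ) ≤ 3 * (m : ℝ) ^ (1 / 2 : ℝ) := by
    have h1 : (Nat.sqrt m : ℝ) ≤ Real.sqrt m := Real.nat_sqrt_le_real_sqrt
    have h2 : 1 ≤ Real.sqrt m := Real.one_le_sqrt.mpr hm1
    rw [← hsqrt]; linarith
  have hlog0 : 0 ≤ Real.log m := Real.log_nonneg hm1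
  calc Real.log m * (2 * (2 * D + 1) * (2 * Nat.sqrt m + 1))
      ≤ (2 / η * (m : ℝ) ^ (η / 2)) * (2 * (3 * (m : ℝ) ^ (1 / 2 - η)) * (3 * (m : ℝ) ^ (1 / 2 : ℝ))) := by
        refine mul_le_mul hlog ?_ (by positivity) (by positivity)
        exact mul_le_mul (by linarith) hS1 (by positivity) (by positivity)
    _ = 36 / η * ((m : ℝ) ^ (η / 2) * (m : ℝ) ^ (1 / 2 - η) * (m : ℝ) ^ (1 / 2 : ℝ)) := by ring
    _ = 36 / η * (m : ℝ) ^ (1 - η / 2) := by rw [hpow, hpow]; ring_nf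

/-- Numerics (iii): the prime powers `(√m+1)(log₂ m+1) log m · C_τ m^{1/8} ≤ 2048 C_τ m^{e}` (`e ≥ 3/4`).
[folklore] -/
private theorem numerics_pp {m : ℕ} (hm : 2 ≤ m) {Cτ e : ℝ} (hCτ0 : 0 ≤ Cτ) (he : 3 / 4 ≤ e) :
    (((Nat.sqrt m + 1) * (Nat.log 2 m + 1) : ℕ) : ℝ) * (Real.log m * (Cτ * (m : ℝ) ^ (1 / 8 : ℝ))) ≤
      2048 * Cτ * (m : ℝ) ^ e := by
  have hm1 : (1 : ℝ) ≤ m := by exact_mod_cast (by omega : 1 ≤ m)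
  have hm0 : (0 : ℝ) < m := by linarith
  have hm2 : (2 : ℝ) ≤ m := by exact_mod_cast hm
  have hpow : ∀ a b : ℝ, (m : ℝ) ^ a * (m : ℝ) ^ b = (m : ℝ) ^ (a + b) := fun a b => (Real.rpow_add hm0 a b).symm
  have hsqrt : Real.sqrt m = (m : ℝ) ^ (1 / 2 : ℝ) := Real.sqrt_eq_rpow _
  have hl2 : (1 : ℝ) / 2 < Real.log 2 := by have := Real.log_two_gt_d9; linarith
  have hlogm2 : Real.log 2 ≤ Real.log m := Real.log_le_log (by norm_num) hm2
  have hS : ((Nat.sqrt m : ℕ) : ℝ) + 1 ≤ 2 * (m : ℝ) ^ (1 / 2 : ℝ) := by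
    have h1 : (Nat.sqrt m : ℝ) ≤ Real.sqrt m := Real.nat_sqrt_le_real_sqrt
    have h2 : 1 ≤ Real.sqrt m := Real.one_le_sqrt.mpr hm1
    rw [← hsqrt]; linarith
  have hL : ((Nat.log 2 m : ℕ) : ℝ) + 1 ≤ 4 * Real.log m := by
    have h1 : (2 : ℝ) ^ (Nat.log 2 m) ≤ m := by exact_mod_cast Nat.pow_log_le_self 2 (by omega : m ≠ 0)
    have h2 : (Nat.log 2 m : ℝ) * Real.log 2 ≤ Real.log m := by
      rw [← Real.log_pow]; exact Real.log_le_log (by positivity) h1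
    nlinarith
  have hlog16 : Real.log m ≤ 16 * (m : ℝ) ^ (1 / 16 : ℝ) := by
    have := Real.log_le_rpow_div hm0.le (by norm_num : (0 : ℝ) < 1 / 16)
    linarith
  have hlog0 : 0 ≤ Real.log m := Real.log_nonneg hm1
  have hcast : (((Nat.sqrt m + 1) * (Nat.log 2 m + 1) : ℕ) : ℝ) = (((Nat.sqrt m : ℕ) : ℝ) + 1) * (((Nat.log 2 m : ℕ) : ℝ) + 1) := by
    push_cast; ring
  rw [hcast]
  have hA : (((Nat.sqrt m : ℕ) : ℝ) + 1) * (((Nat.log 2 m : ℕ) : ℝ) + 1) ≤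
      (2 * (m : ℝ) ^ (1 / 2 : ℝ)) * (4 * (16 * (m : ℝ) ^ (1 / 16 : ℝ))) :=
    mul_le_mul hS (hL.trans (by linarith)) (by positivity) (by positivity)
  have hB : Real.log m * (Cτ * (m : ℝ) ^ (1 / 8 : ℝ)) ≤ (16 * (m : ℝ) ^ (1 / 16 : ℝ)) * (Cτ * (m : ℝ) ^ (1 / 8 : ℝ)) :=
    mul_le_mul_of_nonneg_right hlog16 (by positivity)
  calc _ ≤ (2 * (m : ℝ) ^ (1 / 2 : ℝ)) * (4 * (16 * (m : ℝ) ^ (1 / 16 : ℝ))) *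
        ((16 * (m : ℝ) ^ (1 / 16 : ℝ)) * (Cτ * (m : ℝ) ^ (1 / 8 : ℝ))) :=
        mul_le_mul hA hB (by positivity) (by positivity)
    _ = 2048 * Cτ * ((m : ℝ) ^ (1 / 2 : ℝ) * (m : ℝ) ^ (1 / 16 : ℝ) * (m : ℝ) ^ (1 / 16 : ℝ) * (m : ℝ) ^ (1 / 8 : ℝ)) := by
        ring
    _ = 2048 * Cτ * (m : ℝ) ^ (3 / 4 : ℝ) := by rw [hpow, hpow, hpow]; norm_num
    _ ≤ 2048 * Cτ * (m : ℝ) ^ e :=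
        mul_le_mul_of_nonneg_left (Real.rpow_le_rpow_of_exponent_le hm1 he) (by positivity)

/-- **The partial sums `Σ_{n ≤ m, n prime} Λ(n) A(n)` have a power saving**: with the constants of
Theorem 2^ψ (exponent `ϑ ∈ [1/2, 1)`), `η = (1-ϑ)/4`, for all `m ≥ 2`,
`|Σ_{n ≤ m} c(n)| ≤ K m^{1-η/2}`. [cite: FriedlanderIwaniecAnnals1998, Theorem 2 (proof via Theorem 2^ψ)] -/
theorem norm_sum_c_le {ϑ Cψ : ℝ} (hCψ : 0 ≤ Cψ) (hϑh : 1 / 2 ≤ ϑ) (hϑ1 : ϑ < 1)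
    (hψ : ∀ χ : MulChar (GaussQuot (4 * 2)) ℂ, ∀ k : ℤ, ∀ x : ℝ, 2 ≤ x →
      ‖vonMangoldtEigenSum 2 χ k 1 x‖ ≤ Cψ * (|k| + 1 : ℝ) * x ^ ϑ)
    {M : ℝ} (hM1 : 1 ≤ M) (hM : ∀ s, |deriv (deriv (deriv Real.smoothTransition)) s| ≤ M)
    {Cτ : ℝ} (hCτ0 : 0 ≤ Cτ) (hCτ : ∀ n : ℕ, n ≠ 0 → (n.divisors.card : ℝ) ≤ Cτ * (n : ℝ) ^ (1 / 8 : ℝ))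
    {m : ℕ} (hm : 2 ≤ m) :
    ‖∑ n ∈ Icc 1 m, (if n.Prime then (Λ n : ℂ) * spinA n else 0)‖ ≤
      (2 * (Fintype.card (GaussQuot (4 * 2)) * (Cψ * (1 + 128 * M)) + 36 / ((1 - ϑ) / 4)) + 2048 * Cτ) *
        (m : ℝ) ^ (1 - (1 - ϑ) / 4 / 2) := by
  set η : ℝ := (1 - ϑ) / 4 with hη
  have hη0 : 0 < η := by rw [hη]; linarith
  have hη8 : η ≤ 1 / 8 := by rw [hη]; linarith
  have hm1 : (1 : ℝ) ≤ m := by exact_mod_cast (by omega : 1 ≤ m)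
  have hm0 : (0 : ℝ) < m := by linarith
  -- the smoothing width
  set t : ℝ := (m : ℝ) ^ (-η) with ht
  have ht0 : 0 < t := Real.rpow_pos_of_pos hm0 _
  have ht1 : t ≤ 1 := Real.rpow_le_one_of_one_le_of_nonpos hm1 (by linarith)
  set Δ : ℝ := min (1 / 2) t with hΔ
  have hΔ0 : 0 < Δ := lt_min (by norm_num) ht0
  have hΔ2 : Δ ≤ 1 / 2 := min_le_left _ _
  have hΔt : Δ ≤ t := min_le_right _ _
  have hΔlow : t / 2 ≤ Δ := le_min (by linarith) (by linarith)
  set D : ℕ := ⌊Δ * Real.sqrt m⌋₊ with hD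
  have hDlt : Δ * Real.sqrt m < D + 1 := Nat.lt_floor_add_one _
  have hU := norm_sum_vonMangoldt_spinA_le hCψ hψ (by linarith) hM hΔ0 hΔ2 hm hDlt
  have hPP := norm_sum_notPrime_le hCτ (y := m) (by omega)
  have n1 := numerics_main hm hη0 hη ht hΔlow hCψ hM1
    (Nat.cast_nonneg (Fintype.card (GaussQuot (4 * 2))))
  have n2 := numerics_err hm hη0 hη8 ht hΔ0 hΔt hD
  have n3 := numerics_pp hm hCτ0 (e := 1 - η / 2) (by linarith)
  rw [sum_c_eq, show (1 - (1 - ϑ) / 4 / 2 : ℝ) = 1 - η / 2 by rw [hη]]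
  refine (norm_sub_le _ _).trans ?_
  calc ‖∑ n ∈ Icc 1 m, (Λ n : ℂ) * spinA n‖ + ‖∑ n ∈ (Icc 1 m).filter (fun n => ¬ n.Prime), (Λ n : ℂ) * spinA n‖
      ≤ 2 * (Fintype.card (GaussQuot (4 * 2)) * (Cψ * (1 + 128 * M)) * (m : ℝ) ^ (1 - η / 2) +
          36 / η * (m : ℝ) ^ (1 - η / 2)) + 2048 * Cτ * (m : ℝ) ^ (1 - η / 2) :=
        add_le_add (hU.trans (by linarith)) (hPP.trans n3)
    _ = _ := by ring

end Literature.NumberTheory.Sieve.FriedlanderIwaniecPrimes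

namespace Literature.NumberTheory.Sieve

open FriedlanderIwaniecPrimes
open Literature.NumberTheory.QuadraticFields.GaussianPrimary

/-- **Friedlander–Iwaniec, Theorem 2 (power-saving form) from Theorem 2^ψ (power-saving form)** — the
stripping (23.1) → (23.3): if `Σ_{n ≤ x} Λ(n) λ(cn) ≪ c d(|k|+1) x^ϑ` for some `ϑ < 1` and all Hecke
characters `ψ = χ (z/|z|)^k` (`χ (mod 4d)`), then `Σ_{r²+s²=p≤x} (s/r) ≪ x^{1-δ}` for some `δ > 0`
(`δ = (1 - max(ϑ, 1/2))/8`). [cite: FriedlanderIwaniecAnnals1998, Theorem 2, §23 (23.1)–(23.3)] -/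
theorem FriedlanderIwaniec1998_theorem2_powerSaving_of_theorem2psi
    (h : FriedlanderIwaniec1998_theorem2psi_powerSaving) : FriedlanderIwaniec1998_theorem2_powerSaving := by
  obtain ⟨ϑ₀, hϑ₀, C, hC⟩ := h
  set ϑ : ℝ := max ϑ₀ (1 / 2) with hϑdef
  have hϑ1 : ϑ < 1 := max_lt hϑ₀ (by norm_num)
  have hϑh : 1 / 2 ≤ ϑ := le_max_right _ _
  set Cψ : ℝ := 2 * max C 0 with hCψ
  have hCψ0 : 0 ≤ Cψ := by positivity
  have hψ : ∀ χ : MulChar (GaussQuot (4 * 2)) ℂ, ∀ k : ℤ, ∀ x : ℝ, 2 ≤ x →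
      ‖vonMangoldtEigenSum 2 χ k 1 x‖ ≤ Cψ * (|k| + 1 : ℝ) * x ^ ϑ := by
    intro χ k x hx
    have h1 := hC 2 (by norm_num) χ k 1 le_rfl x hx
    have hx1 : (1 : ℝ) ≤ x := by linarith
    have hk0 : (0 : ℝ) ≤ (|k| + 1 : ℝ) := by positivity
    have hxϑ : x ^ ϑ₀ ≤ x ^ ϑ := Real.rpow_le_rpow_of_exponent_le hx1 (le_max_left _ _)
    calc ‖vonMangoldtEigenSum 2 χ k 1 x‖ ≤ C * (1 : ℕ) * ((2 : ℕ) * (|k| + 1 : ℝ)) * x ^ ϑ₀ := h1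
      _ = C * (2 * (|k| + 1 : ℝ) * x ^ ϑ₀) := by push_cast; ring
      _ ≤ max C 0 * (2 * (|k| + 1 : ℝ) * x ^ ϑ) := by
          have h0 : 0 ≤ 2 * (|k| + 1 : ℝ) * x ^ ϑ₀ := by positivity
          calc C * (2 * (|k| + 1 : ℝ) * x ^ ϑ₀) ≤ max C 0 * (2 * (|k| + 1 : ℝ) * x ^ ϑ₀) :=
                mul_le_mul_of_nonneg_right (le_max_left _ _) h0
            _ ≤ max C 0 * (2 * (|k| + 1 : ℝ) * x ^ ϑ) :=
                mul_le_mul_of_nonneg_left (mul_le_mul_of_nonneg_left hxϑ (by positivity)) (le_max_right _ _)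
      _ = Cψ * (|k| + 1 : ℝ) * x ^ ϑ := by rw [hCψ]; ring
  obtain ⟨M, hM1, hM⟩ := exists_bound_deriv3_smoothTransition
  obtain ⟨Cτ, hCτ1, hCτ⟩ := Literature.NumberTheory.Sieve.exists_card_divisors_le_mul_rpow
    (ε := 1 / 8) (by norm_num)
  set η : ℝ := (1 - ϑ) / 4 with hη
  have hη0 : 0 < η := by rw [hη]; linarith
  set K : ℝ := 2 * (Fintype.card (GaussQuot (4 * 2)) * (Cψ * (1 + 128 * M)) + 36 / ((1 - ϑ) / 4)) + 2048 * Cτ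
    with hK
  have hK0 : 0 ≤ K := by
    have : 0 ≤ 36 / ((1 - ϑ) / 4) := by rw [← hη]; positivity
    have : (0 : ℝ) ≤ 1 + 128 * M := by linarith
    positivity
  refine ⟨η / 2, by positivity, 1 + 2 * K, fun x hx => ?_⟩
  set N : ℕ := ⌊x⌋₊ with hN
  have hN2 : 2 ≤ N := Nat.le_floor (by exact_mod_cast hx)
  have hx0 : 0 < x := by linarith
  have hNx : (N : ℝ) ≤ x := Nat.floor_le hx0.le
  have hN0 : (0 : ℝ) < N := by exact_mod_cast (by omega : 0 < N)
  -- the partial sums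
  have hpartial : ∀ m : ℕ, 1 ≤ m → m ≤ N →
      ‖∑ n ∈ Icc 1 m, (if n.Prime then (Λ n : ℂ) * spinA n else 0)‖ ≤ K * (N : ℝ) ^ (1 - η / 2) := by
    intro m hm1 hmN
    rcases Nat.lt_or_ge m 2 with hm2 | hm2
    · have : m = 1 := by omega
      subst this
      simp [Nat.not_prime_one]
      positivity
    · have h := norm_sum_c_le hCψ0 hϑh hϑ1 hψ hM1 hM (by linarith) hCτ hm2
      rw [← hK, ← hη] at h
      refine h.trans (mul_le_mul_of_nonneg_left ?_ hK0)
      exact Real.rpow_le_rpow (by positivity) (by exact_mod_cast hmN) (by linarith)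
  -- Abel summation with `f(n) = 1/log(max(n,2))`
  set f : ℕ → ℝ := fun n => 1 / Real.log ((max n 2 : ℕ) : ℝ) with hf
  have hfpos : ∀ n, 0 < Real.log ((max n 2 : ℕ) : ℝ) := fun n =>
    Real.log_pos (by exact_mod_cast (by omega : 1 < max n 2))
  have hf0 : 0 ≤ f N := by rw [hf]; exact (one_div_pos.mpr (hfpos N)).le
  have hfanti : ∀ n, 1 ≤ n → n < N → f (n + 1) ≤ f n := by
    intro n _ _
    rw [hf]
    exact one_div_le_one_div_of_le (hfpos n)
      (Real.log_le_log (by positivity) (by exact_mod_cast (by omega : max n 2 ≤ max (n + 1) 2)))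
  have habel := norm_sum_Icc_mul_le_of_antitone (a := 1) (by omega) (c := fun n =>
    if n.Prime then (Λ n : ℂ) * spinA n else 0) hf0 hfanti hpartial
  have hf1 : f 1 ≤ 2 := by
    rw [hf]; simp only [show ((max 1 2 : ℕ) : ℝ) = 2 by norm_num]
    rw [div_le_iff₀ (Real.log_pos (by norm_num))]
    have := Real.log_two_gt_d9; linarith
  -- the spin sum
  have hspin := spinSum_eq (x := x) hN2
  have hnorm : |(spinSum x : ℝ)| = ‖((spinSum x : ℤ) : ℂ)‖ := by rw [Complex.norm_intCast]
  rw [hnorm, hspin]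
  have hxpow : (N : ℝ) ^ (1 - η / 2) ≤ x ^ (1 - η / 2) := Real.rpow_le_rpow hN0.le hNx (by linarith)
  have hx1 : 1 ≤ x ^ (1 - η / 2) := Real.one_le_rpow (by linarith) (by linarith)
  calc ‖(1 : ℂ) + ∑ n ∈ Icc 1 N, (if n.Prime then (Λ n : ℂ) * spinA n else 0) * ((f n : ℝ) : ℂ)‖
      ≤ 1 + K * (N : ℝ) ^ (1 - η / 2) * f 1 := by
        refine (norm_add_le _ _).trans (add_le_add (by simp) habel)
    _ ≤ 1 + K * x ^ (1 - η / 2) * 2 := by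
        have : K * (N : ℝ) ^ (1 - η / 2) * f 1 ≤ K * x ^ (1 - η / 2) * 2 :=
          mul_le_mul (mul_le_mul_of_nonneg_left hxpow hK0) hf1 (by rw [hf]; exact (one_div_pos.mpr (hfpos 1)).le)
            (by positivity)
        linarith
    _ ≤ (1 + 2 * K) * x ^ (1 - η / 2) := by nlinarith

/-- **Friedlander–Iwaniec, Theorem 2 with a power saving — PROVED**: there are `δ > 0` and `C` with
`|Σ_{p ≤ x} Σ_{r² + s² = p, r,s ≥ 1, r odd} (s/r)| ≤ C x^{1-δ}` for all `x ≥ 2` (the spins of the primes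
`p ≡ 1 (mod 4)` are equidistributed with a power saving). From Theorem 2^ψ
(`FriedlanderIwaniec1998_theorem2psi_powerSaving_holds`) by the stripping above.
[cite: FriedlanderIwaniecAnnals1998, Theorem 2] -/
theorem FriedlanderIwaniec1998_theorem2_powerSaving_holds : FriedlanderIwaniec1998_theorem2_powerSaving :=
  FriedlanderIwaniec1998_theorem2_powerSaving_of_theorem2psi FriedlanderIwaniec1998_theorem2psi_powerSaving_holds

end Literature.NumberTheory.Sieve
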